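import Mathlib
import Literature.MathematicalPhysics.QuantumLattice.FermiRG.Salmhofer1998WickReordering
import Literature.MathematicalPhysics.QuantumLattice.GrassmannPairLaplacians
import Literature.MathematicalPhysics.QuantumLattice.GrassmannLaplacianGramBound
import Literature.MathematicalPhysics.QuantumLattice.GrassmannKernelAntisymmetry
import HarnessLib

/-!
# Salmhofer 1998, Proposition 2 (Appendix B "Wick reordering") — PROOF: discharge of `WickReorderingFormula`

Theorem-only companion (kind `proof`; no definition, no named fact, no `instance`, no `notation`, no `sorry`) of the
DEFINITION-FROZEN typer file F7aj `Salmhofer1998WickReordering.lean` of the cell `gate-hubbard-kl` (statements-first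
wave D-0069 (2); DAG row `Sal98.P2`, licence F-078).  It proves

* **`WickReorderingFormula_holds : WickReorderingFormula`** — M. Salmhofer, *Continuous renormalization for fermions
  and Fermi liquid theory*, Commun. Math. Phys. **194** (1998) 249–295 [Salmhofer1998], **Proposition 2** (render
  `paper:arxiv-cond-mat_9706188` p0012 L69–106) with (3.16)–(3.17) (p0012 L47–63): the order-`r` bilinear term of the
  RGE, `Σ_{r₁+r₂=r} (δ𝒢_{r₁}/δψ, Ċ δ𝒢_{r₂}/δψ)_Γ`, is `Σ_m ∫dX Q_{m,r}(X) Ω_D(ψ(X))` with `Q_{m,r}` the determinant formula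
  `∫dκ_{mr} Σ_{V,W} σ(i) ∂_t det𝒟^{(i)}(V,W) G_{m₁r₁}(X₁,V) G_{m₂r₂}(W̃,X₂)` — for a finite label set and antisymmetric
  `D`, `Ḋ`, as typed in F7aj (the `∃ σ` form); and the stronger
* **`wickReorderingFormula_wickReorderSign`** — the same identity with the sign EXHIBITED, `σ(i) = (-1)^{i-1}`
  (`wickReorderSign` of F7aj).  This settles the cell's flag S-t7g12-1 (F7aj module docstring "SIGN": Proposition 2
  prints `-∂_t det` for every `i`, (4.3) prints `+∂_t det` for every `i`; in the tree's conventions — F7x left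
  derivatives and pairing, F7z `Ω_D = e^{-Δ_D}`, all ref-2-verified against print — the kernel now certifies
  `σ(1) = +1`, `σ(2) = -1`, `σ(i) = (-1)^{i-1}`).  The hypothesis `Ḋᵀ = -Ḋ` of the named fact is not used.

## The proof (Appendix B, render p0030 L1 – p0031 L145, re-organised as finite Grassmann operator calculus)

Print derives Proposition 2 with source fields `η` (generating function `Z(η,ψ)`, Lemma 10 "left to the reader",
the expansion (B.9)–(B.15) of `η_1⋯η_μ exp(∂⃖_{η^{(1)}} D_t ∂⃖_{η^{(2)}})` over line sets `L ⊂ M₁ × M₂`).  Here the same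
combinatorics is obtained from the operator calculus already in the tree, in five steps:

1. `wickOrder_gen_mul'`: `Ω_D(ψ(X) a) = ψ(X) Ω_D(a) + Σ_Y D(X,Y) ∂_Y Ω_D(a)` (from `gaussConv_gen_mul` of
   `GrassmannIntegrationByParts.lean` at the covariance `-D`; "the antisymmetry of `D_t`", p0030 L88), and the
   resulting **recursion in Wick coordinates** `gaussConv_wickOrder_gen_mul_mul`:
   `e^{Δ_D}(Ω_D(ψ(X)α)·Ω_D β) = ψ(X)·e^{Δ_D}(Ω_D α·Ω_D β) - (-1)^{|α|} Σ_Y D(X,Y) e^{Δ_D}(Ω_D α·Ω_D(∂_Y β))` — the new field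
   is an external leg or the end of one more internal line (print: "every derivative can act only once", p0030 L144).
2. **Product formula** `gaussConv_wickOrder_presented_mul` (induction on the degree of the first factor; the
   bookkeeping of the index boxes is the abstract `wick_regroup_succ`/`wick_regroup_zero`, the two leg operations are
   `kernel_ext`/`kernel_contr`): for antisymmetric coefficient functions `A` (degree `p`), `B` (degree `q`),
   `e^{Δ_D}(Ω_D⟪A⟫·Ω_D⟪B⟫) = Σ_{p+q=m+2i} (-1)^i i! C(p,i) C(q,i) ⟪X ↦ Σ_{V,W∈Γ^i} ∏_k D(V_k,W_k) A(X₁,V) B(W̃,X₂)⟫`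
   with print's placement of the legs (`X₁` then `V` on the first vertex, `W̃` reversed then `X₂` on the second,
   p0012 L99–104) and print's count `κ_{pqi}·i!` of graphs with the same value (p0031 L118–125, L158–163); the sign
   `(-1)^i` is one `-D` per internal line in the tree's convention `Ω_D(ψψ') = ψψ' + D`.
3. **Pairing** `grassmannDerivPairing_wickOrder_presented`: the two derivatives of `(δ·/δψ, C' δ·/δψ)_Γ` fix one more
   line carrying `C'` (`grassmannDeriv_presented`: `∂_X ⟪A⟫ = (p+1)⟪A(X,·)⟫`), p0030 L19–27.
4. **Determinant collapse** `sum_detDeriv_covMatrix_mul`: against a function antisymmetric in the `V`- and in the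
   `W`-legs, `Σ_{V,W} ∂det[𝒟_D^{(i+1)}](𝒟_E)(V,W) Φ = (i+1)(i+1)! Σ_{V,W} E(V_last,W_last) ∏_{k<last} D(V_k,W_k) Φ` ("the
   sum over permutations `π` gives the determinant", p0031 L127, read backwards, plus the `i+1` equal
   column-replacement terms of (4.2), p0014 L17–27); the antisymmetry of `G(X₁,V)` in `V` and of `G(W̃,X₂)` in `W` is
   transported from `kernel_comp_perm` by `argA_comp_perm`/`argB_comp_perm` (`Equiv.Perm.extendDomain`).
5. **Assembly** `wickReorderingFormula_wickReorderSign`: expansion of `𝒢_{r₁}`, `𝒢_{r₂}` in Wick coefficients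
   (`eq_algebraMap_add_sum_Icc`, the scalar part drops out of the pairing), bilinearity, the per-pair identity
   `grassmannDerivPairing_wickOrder_presented_eq_pairKernel` (coefficient identity `wickCoeff_pairing`:
   `(p+1)(q+1) i! C(p,i)C(q,i) = (i+1)(i+1)! κ_{p+1,q+1,i+1}`), and the index test `MIndex` of F7b (parity from
   `𝒢_r` even: odd Wick coefficients vanish; degrees above `m̄(r)` vanish by hypothesis; degrees above `|Γ|` carry
   zero monomials).  The sign comes out as `(-1)^{m₁}(-1)^{i-1}`, i.e. `(-1)^{i-1}` on the even degrees `m₁` that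
   `MIndex` keeps.

All statements are over a commutative `ℚ`-algebra `R` up to §Pairing (generic Grassmann calculus, reusable by the
Wick-scheme users of the KL programme) and over `ℂ` from §DetCollapse on (F7b/F7aj vocabulary `covMatrix`,
`detDeriv`, `pairKernel`, `kappa`, `MIndex`, `kappaSum`, `wickReorderKernel` are `ℂ`-valued).  Locators `p.N Ln` /
`render pNNNN:Ln` = chunk `pNNNN.txt` line `n` of the materialised arXiv TeX of cond-mat/9706188 (cell render
HOME/dag/texts/paper-arxiv-cond-mat_9706188), as in F7aj; Appendix B = §10 of the arXiv TeX (p0030 L1 – p0031 L171,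
Lemma 10 at p0030 L98–122).  Nothing here is a claim about the Hubbard model; no sorry/axiom beyond the standard three.
-/

noncomputable section

namespace Literature.MathematicalPhysics.QuantumLattice.FermiRG

namespace Salmhofer1998

open GrassmannAlgebra Finset

section Core0

variable (R : Type*) [CommRing R] {Γ : Type*} [Fintype Γ] [DecidableEq Γ]

/-- Peeling the first field of a presented polynomial. [folklore] -/
private theorem presented_succ {n : ℕ} (K : (Fin (n + 1) → Γ) → R) :
    presented R K = ∑ x : Γ, gen R x * presented R (fun Z : Fin n → Γ => K (Fin.cons x Z)) := by
  rw [presented, ← (Fin.consEquiv fun _ => Γ).sum_comp, Fintype.sum_prod_type]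
  refine Finset.sum_congr rfl fun x _ => ?_
  rw [presented, Finset.mul_sum]
  refine Finset.sum_congr rfl fun Z _ => ?_
  simp only [Fin.consEquiv, Equiv.coe_fn_mk, genProd_succ, Fin.cons_zero, Fin.tail_cons, mul_smul_comm]

/-- `presented` of a negated presentation. [folklore] -/
private theorem presented_neg {k : ℕ} (φ : (Fin k → Γ) → R) : presented R (-φ) = -presented R φ := by
  simp [presented, neg_smul]

omit [Fintype Γ] [DecidableEq Γ] in
/-- Antisymmetry of a coefficient function is inherited by fixing the first argument. [folklore] -/
private theorem antisymm_cons {p : ℕ} {A : (Fin (p + 1) → Γ) → R}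
    (hA : ∀ (σ : Equiv.Perm (Fin (p + 1))) (Y : Fin (p + 1) → Γ), A (Y ∘ σ) = ((Equiv.Perm.sign σ : ℤ) : R) * A Y)
    (x : Γ) (τ : Equiv.Perm (Fin p)) (Z : Fin p → Γ) :
    A (Fin.cons x (Z ∘ τ)) = ((Equiv.Perm.sign τ : ℤ) : R) * A (Fin.cons x Z) := by
  have hcomp : (Fin.cons x Z : Fin (p + 1) → Γ) ∘ (Equiv.Perm.decomposeFin.symm (0, τ)) = Fin.cons x (Z ∘ τ) := by
    funext i
    refine Fin.cases ?_ (fun j => ?_) i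
    · simp [Equiv.Perm.decomposeFin_symm_apply_zero]
    · simp [Equiv.Perm.decomposeFin_symm_apply_succ, Equiv.swap_self]
  rw [← hcomp, hA, Equiv.Perm.decomposeFin.symm_sign, if_pos rfl, one_mul]

omit [Fintype Γ] [DecidableEq Γ] in
/-- Swapping the first two arguments of an antisymmetric coefficient function. [folklore] -/
private theorem antisymm_cons_cons {p : ℕ} {A : (Fin (p + 2) → Γ) → R}
    (hA : ∀ (σ : Equiv.Perm (Fin (p + 2))) (Y : Fin (p + 2) → Γ), A (Y ∘ σ) = ((Equiv.Perm.sign σ : ℤ) : R) * A Y)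
    (x y : Γ) (Z : Fin p → Γ) :
    A (Fin.cons x (Fin.cons y Z)) = -A (Fin.cons y (Fin.cons x Z)) := by
  have hcomp : (Fin.cons y (Fin.cons x Z) : Fin (p + 2) → Γ) ∘ (Equiv.swap (0 : Fin (p + 2)) 1) =
      Fin.cons x (Fin.cons y Z) := by
    funext i
    refine Fin.cases ?_ (fun j => Fin.cases ?_ (fun k => ?_) j) i
    · simp [Equiv.swap_apply_left]
    · simp [Equiv.swap_apply_right]
    · have h0 : (k.succ.succ : Fin (p + 2)) ≠ 0 := Fin.succ_ne_zero _
      have h1 : (k.succ.succ : Fin (p + 2)) ≠ 1 := by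
        rw [← Fin.succ_zero_eq_one]; exact fun h => Fin.succ_ne_zero _ (Fin.succ_injective _ h)
      simp [Equiv.swap_apply_of_ne_of_ne h0 h1]
  rw [← hcomp, hA, Equiv.Perm.sign_swap (Fin.zero_ne_one (n := p))]
  simp

/-- The derivative of a presented antisymmetric polynomial of degree `p + 1`. [cite: Salmhofer1998, Appendix B, `∂/∂ψ(X)` of a monomial (render p0030:L22-L58)] -/
theorem grassmannDeriv_presented : ∀ {p : ℕ} (A : (Fin (p + 1) → Γ) → R)
    (_hA : ∀ (σ : Equiv.Perm (Fin (p + 1))) (Y : Fin (p + 1) → Γ), A (Y ∘ σ) = ((Equiv.Perm.sign σ : ℤ) : R) * A Y)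
    (X : Γ), grassmannDeriv R X (presented R A) =
      ((p + 1 : ℕ) : R) • presented R (fun Z : Fin p → Γ => A (Fin.cons X Z))
  | 0, A, _, X => by
    rw [presented_succ, map_sum]
    have h : ∀ x : Γ, grassmannDeriv R X (gen R x * presented R fun Z : Fin 0 → Γ => A (Fin.cons x Z)) =
        if X = x then presented R (fun Z : Fin 0 → Γ => A (Fin.cons x Z)) else 0 := by
      intro x
      rw [grassmannDeriv_gen_mul, presented]
      simp only [genProd_zero, map_sum, map_smul, grassmannDeriv_one, smul_zero, Finset.sum_const_zero, mul_zero,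
        sub_zero]
    simp only [h, Finset.sum_ite_eq, Finset.mem_univ, if_true, zero_add, Nat.cast_one, one_smul]
  | p + 1, A, hA, X => by
    rw [presented_succ, map_sum]
    have h : ∀ x : Γ, grassmannDeriv R X (gen R x * presented R fun Z : Fin (p + 1) → Γ => A (Fin.cons x Z)) =
        (if X = x then presented R (fun Z : Fin (p + 1) → Γ => A (Fin.cons x Z)) else 0) +
          ((p + 1 : ℕ) : R) • (gen R x * presented R fun Z : Fin p → Γ => A (Fin.cons X (Fin.cons x Z))) := by
      intro x
      rw [grassmannDeriv_gen_mul, grassmannDeriv_presented (fun Z : Fin (p + 1) → Γ => A (Fin.cons x Z))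
        (fun τ Z => antisymm_cons R hA x τ Z) X, sub_eq_add_neg, mul_smul_comm, ← smul_neg, ← mul_neg, ← presented_neg]
      congr 4
      funext Z
      simp only [Pi.neg_apply]
      rw [antisymm_cons_cons R hA, neg_neg]
    simp only [h, Finset.sum_add_distrib, Finset.sum_ite_eq, Finset.mem_univ, if_true, ← Finset.smul_sum]
    rw [← presented_succ R (fun Y : Fin (p + 1) → Γ => A (Fin.cons X Y))]
    rw [show (((p + 1 + 1 : ℕ) : R)) = 1 + ((p + 1 : ℕ) : R) by push_cast; ring, add_smul, one_smul]

end Core0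

section Core1

variable (R : Type*) [CommRing R] [Algebra ℚ R] {Γ : Type*} [Fintype Γ] [DecidableEq Γ]

/-- **Wick ordering past one field** for an antisymmetric covariance:
`Ω_D(ψ(X) a) = ψ(X) Ω_D(a) + Σ_Y D(X,Y) ∂_Y Ω_D(a)`. [cite: Salmhofer1998, Appendix B, "the antisymmetry of `D_t`" (render p0030:L88-L96); Salmhofer1999, §4.3.2 (4.90)] -/
theorem wickOrder_gen_mul' {D : Matrix Γ Γ R} (hD : D.transpose = -D) (X : Γ) (a : GrassmannAlgebra R Γ) :
    wickOrder R D (gen R X * a) =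
      gen R X * wickOrder R D a + ∑ Y, D X Y • grassmannDeriv R Y (wickOrder R D a) := by
  rw [wickOrder_def, gaussConv_gen_mul]
  congr 1
  refine Finset.sum_congr rfl fun Y _ => ?_
  have hYX : D Y X = -D X Y := by
    have h := congrFun (congrFun hD X) Y
    rwa [Matrix.transpose_apply, Matrix.neg_apply] at h
  rw [Matrix.neg_apply, Matrix.neg_apply, hYX, neg_neg, sub_neg_eq_add, half_smul_one_mul_add_self]

/-- **The Gaussian convolution past one field** for an antisymmetric covariance:
`μ_D ⋆ (ψ(X) a) = ψ(X) (μ_D ⋆ a) - Σ_Y D(X,Y) ∂_Y (μ_D ⋆ a)`. [cite: Salmhofer1999, §4.3.2 (4.90)] -/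
theorem gaussConv_gen_mul' {D : Matrix Γ Γ R} (hD : D.transpose = -D) (X : Γ) (a : GrassmannAlgebra R Γ) :
    gaussConv R D (gen R X * a) =
      gen R X * gaussConv R D a - ∑ Y, D X Y • grassmannDeriv R Y (gaussConv R D a) := by
  rw [gaussConv_gen_mul, sub_eq_add_neg, ← Finset.sum_neg_distrib]
  congr 1
  refine Finset.sum_congr rfl fun Y _ => ?_
  have hYX : D Y X = -D X Y := by
    have h := congrFun (congrFun hD X) Y
    rwa [Matrix.transpose_apply, Matrix.neg_apply] at h
  rw [hYX, show -D X Y - D X Y = -(D X Y + D X Y) by ring, mul_neg, half_smul_one_mul_add_self, neg_smul]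

/-- The parity of a Wick-ordered presented polynomial of degree `p`: `involute (Ω_D ⟪A⟫) = (-1)^p Ω_D ⟪A⟫`. [folklore] -/
private theorem involute_wickOrder_presented (D : Matrix Γ Γ R) {p : ℕ} (A : (Fin p → Γ) → R) :
    CliffordAlgebra.involute (wickOrder R D (presented R A)) = ((-1 : R) ^ p) • wickOrder R D (presented R A) := by
  have hmem : wickOrder R D (presented R A) ∈ evenOdd R (p : ZMod 2) := by
    rw [wickOrder_def]
    refine gaussConv_mem_evenOdd R _ ?_
    rw [presented]
    exact Submodule.sum_mem _ fun Y _ => Submodule.smul_mem _ _ (genProd_mem_evenOdd R Y)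
  rcases Nat.even_or_odd p with hp | hp
  · rw [(ZMod.natCast_eq_zero_iff_even).2 hp] at hmem
    rw [CliffordAlgebra.involute_eq_of_mem_even hmem, hp.neg_one_pow, one_smul]
  · rw [(ZMod.natCast_eq_one_iff_odd).2 hp] at hmem
    rw [CliffordAlgebra.involute_eq_of_mem_odd hmem, hp.neg_one_pow, neg_one_smul]

/-- **The recursion**: in Wick coordinates, multiplying the first factor by one more field either keeps the field
external or contracts it with a field of the second factor. [cite: Salmhofer1998, Appendix B, "every derivative can act only once" / internal vs external legs (render p0030:L144-L170, p0031:L146-L160)] -/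
theorem gaussConv_wickOrder_gen_mul_mul {D : Matrix Γ Γ R} (hD : D.transpose = -D) (X : Γ)
    (α β : GrassmannAlgebra R Γ) {ε : R} (hα : CliffordAlgebra.involute (wickOrder R D α) = ε • wickOrder R D α) :
    gaussConv R D (wickOrder R D (gen R X * α) * wickOrder R D β) =
      gen R X * gaussConv R D (wickOrder R D α * wickOrder R D β) -
        ε • ∑ Y, D X Y • gaussConv R D (wickOrder R D α * wickOrder R D (grassmannDeriv R Y β)) := by
  have hderiv : ∀ Y, grassmannDeriv R Y (gaussConv R D (wickOrder R D α * wickOrder R D β)) =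
      gaussConv R D (grassmannDeriv R Y (wickOrder R D α) * wickOrder R D β) +
        ε • gaussConv R D (wickOrder R D α * wickOrder R D (grassmannDeriv R Y β)) := by
    intro Y
    rw [grassmannDeriv_gaussConv, grassmannDeriv_mul, hα, map_add, smul_mul_assoc, map_smul, wickOrder_def,
      grassmannDeriv_gaussConv R (-D) Y β]
  rw [wickOrder_gen_mul' R hD, add_mul, map_add, mul_assoc, gaussConv_gen_mul' R hD, Finset.sum_mul, map_sum]
  simp only [hderiv, smul_add, Finset.sum_add_distrib, smul_mul_assoc, map_smul, Finset.smul_sum, smul_comm ε]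
  abel

end Core1

section Index

variable {R : Type*} [CommRing R] {Γ : Type*} [Fintype Γ] (D : Matrix Γ Γ R)

/-- **External leg**: the `(p+1, q, i)` kernel at `X : Fin (m+1) → Γ` is the `(p, q, i)` kernel of `A(X₀, ·)` at the tail of `X`. [cite: Salmhofer1998, Appendix B, renaming of the external legs (render p0031:L53-L95)] -/
theorem kernel_ext {p q i m : ℕ} (h : i ≤ p ∧ i ≤ q ∧ p + q = m + 2 * i)
    (A : (Fin (p + 1) → Γ) → R) (B : (Fin q → Γ) → R) (X : Fin (m + 1) → Γ) :
    (∑ V : Fin (i) → Γ, ∑ W : Fin (i) → Γ, (∏ k, D (V k) (W k)) *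
          (A (fun j : Fin (p + 1) => if hj : (j : ℕ) < p + 1 - (i) then X ⟨j, by omega⟩ else V ⟨j - (p + 1 - (i)), by omega⟩) *
            B (fun j : Fin (q) => if hj : (j : ℕ) < i then W ⟨i - 1 - j, by omega⟩ else X ⟨p + 1 - (i) + (j - (i)), by omega⟩))) =
    (∑ V : Fin (i) → Γ, ∑ W : Fin (i) → Γ, (∏ k, D (V k) (W k)) *
          ((fun Y : Fin p → Γ => A (Fin.cons (X 0) Y)) (fun j : Fin (p) => if hj : (j : ℕ) < p - (i) then (Fin.tail X) ⟨j, by omega⟩ else V ⟨j - (p - (i)), by omega⟩) *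
            B (fun j : Fin (q) => if hj : (j : ℕ) < i then W ⟨i - 1 - j, by omega⟩ else (Fin.tail X) ⟨p - (i) + (j - (i)), by omega⟩))) := by
  refine Finset.sum_congr rfl fun V _ => Finset.sum_congr rfl fun W _ => ?_
  congr 2
  · congr 1
    funext j
    refine Fin.cases ?_ (fun j' => ?_) j
    · rw [dif_pos (by simp; omega), Fin.cons_zero]
      simp
    · simp only [Fin.cons_succ, Fin.val_succ]
      by_cases hj : (j' : ℕ) < p - i
      · rw [dif_pos (by omega), dif_pos hj]
        rfl
      · rw [dif_neg (by omega), dif_neg hj]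
        congr 1
        ext
        simp only
        omega
  · congr 1
    funext j
    by_cases hj : (j : ℕ) < i
    · rw [dif_pos hj, dif_pos hj]
    · rw [dif_neg hj, dif_neg hj]
      simp only [Fin.tail]
      congr 1
      ext
      simp only [Fin.val_succ]
      omega

omit [Fintype Γ] in
/-- The `A`-argument string with one more internal line appended is `Fin.snoc` of the old one. [cite: Salmhofer1998, Appendix B (render p0031:L75-L83, L130-L134)] -/
theorem argA_snoc {p i m : ℕ} (hip : i ≤ p) (hm : p - i ≤ m) (Z : Fin m → Γ) (V : Fin i → Γ) (x : Γ) :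
    (fun j : Fin (p + 1) => if hj : (j : ℕ) < p + 1 - (i + 1) then Z ⟨j, by omega⟩
      else (Fin.snoc V x : Fin (i + 1) → Γ) ⟨j - (p + 1 - (i + 1)), by omega⟩) =
      Fin.snoc (fun j : Fin p => if hj : (j : ℕ) < p - i then Z ⟨j, by omega⟩ else V ⟨j - (p - i), by omega⟩) x := by
  funext j
  refine Fin.lastCases ?_ (fun j' => ?_) j
  · rw [Fin.snoc_last, dif_neg (by simp)]
    have hl : (⟨(Fin.last p : ℕ) - (p + 1 - (i + 1)), by simp; omega⟩ : Fin (i + 1)) = Fin.last i := by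
      ext; simp; omega
    rw [hl, Fin.snoc_last]
  · rw [Fin.snoc_castSucc]
    simp only [Fin.val_castSucc]
    by_cases hj : (j' : ℕ) < p - i
    · rw [dif_pos (by omega), dif_pos hj]
    · rw [dif_neg (by omega), dif_neg hj]
      have hc : (⟨(j' : ℕ) - (p + 1 - (i + 1)), by omega⟩ : Fin (i + 1)) = Fin.castSucc ⟨(j' : ℕ) - (p - i), by omega⟩ := by
        ext; simp
      rw [hc, Fin.snoc_castSucc]

omit [Fintype Γ] in
/-- The `B`-argument string with one more internal line appended is `Fin.cons` of the old one. [cite: Salmhofer1998, Appendix B, `W̃ = (W_i,…,W_1)` (render p0031:L86-L95, L138-L144)] -/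
theorem argB_snoc {p q i m : ℕ} (hip : i ≤ p) (hm : p + q = m + 2 * i) (Z : Fin m → Γ) (W : Fin i → Γ) (y : Γ) :
    (fun j : Fin (q + 1) => if hj : (j : ℕ) < i + 1 then (Fin.snoc W y : Fin (i + 1) → Γ) ⟨i + 1 - 1 - j, by omega⟩
      else Z ⟨p + 1 - (i + 1) + (j - (i + 1)), by omega⟩) =
      Fin.cons y (fun j : Fin q => if hj : (j : ℕ) < i then W ⟨i - 1 - j, by omega⟩ else Z ⟨p - i + (j - i), by omega⟩) := by
  funext j
  refine Fin.cases ?_ (fun j' => ?_) j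
  · rw [Fin.cons_zero, dif_pos (by simp)]
    have hl : (⟨i + 1 - 1 - ((0 : Fin (q + 1)) : ℕ), by simp⟩ : Fin (i + 1)) = Fin.last i := by
      ext; simp
    rw [hl, Fin.snoc_last]
  · rw [Fin.cons_succ]
    simp only [Fin.val_succ]
    by_cases hj : (j' : ℕ) < i
    · rw [dif_pos (by omega), dif_pos hj]
      have hc : (⟨i + 1 - 1 - ((j' : ℕ) + 1), by omega⟩ : Fin (i + 1)) = Fin.castSucc ⟨i - 1 - (j' : ℕ), by omega⟩ := by
        ext; simp; omega
      rw [hc, Fin.snoc_castSucc]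
    · rw [dif_neg (by omega), dif_neg hj]
      congr 1
      ext
      simp only
      omega

omit [Fintype Γ] in
/-- An antisymmetric coefficient function under the cyclic move of the first argument to the end. [cite: Salmhofer1998, Appendix B, sign factors `ε^(b_k - k)` (render p0031:L55-L79)] -/
theorem antisymm_snoc {p : ℕ} {A : (Fin (p + 1) → Γ) → R}
    (hA : ∀ (σ : Equiv.Perm (Fin (p + 1))) (Y : Fin (p + 1) → Γ), A (Y ∘ σ) = ((Equiv.Perm.sign σ : ℤ) : R) * A Y)
    (T : Fin p → Γ) (x : Γ) :
    A (Fin.snoc T x) = ((-1 : R) ^ p) * A (Fin.cons x T) := by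
  rw [Fin.snoc_eq_cons_rotate, show (fun i => (Fin.cons x T : Fin (p + 1) → Γ) (finRotate (p + 1) i)) =
    (Fin.cons x T : Fin (p + 1) → Γ) ∘ (finRotate (p + 1)) from rfl, hA, sign_finRotate]
  simp

/-- Splitting the last entries off two `(i+1)`-strings. [folklore] -/
private theorem sum_sum_snoc {M : Type*} [AddCommMonoid M] {i : ℕ} (F : (Fin (i + 1) → Γ) → (Fin (i + 1) → Γ) → M) :
    ∑ V' : Fin (i + 1) → Γ, ∑ W' : Fin (i + 1) → Γ, F V' W' =
      ∑ x : Γ, ∑ V : Fin i → Γ, ∑ y : Γ, ∑ W : Fin i → Γ,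
        F (Fin.snoc V x : Fin (i + 1) → Γ) (Fin.snoc W y : Fin (i + 1) → Γ) := by
  rw [← (Fin.snocEquiv fun _ => Γ).sum_comp, Fintype.sum_prod_type]
  refine Finset.sum_congr rfl fun x _ => Finset.sum_congr rfl fun V _ => ?_
  rw [← (Fin.snocEquiv fun _ => Γ).sum_comp, Fintype.sum_prod_type]
  rfl

/-- **Contracted leg**: the `(p+1, q+1, i+1)` kernel is `(-1)^p` times the sum of the `(p, q, i)` kernels of
`A(x, ·)`, `B(y, ·)` against `D(x,y)` (the new internal line). [cite: Salmhofer1998, Appendix B, one more internal line `D(X_(b_k), X_(b_(i+π k)))` (render p0031:L9-L23, L53-L95)] -/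
theorem kernel_contr {p q i m : ℕ} (h : i ≤ p ∧ i ≤ q ∧ p + q = m + 2 * i)
    {A : (Fin (p + 1) → Γ) → R}
    (hA : ∀ (σ : Equiv.Perm (Fin (p + 1))) (Y : Fin (p + 1) → Γ), A (Y ∘ σ) = ((Equiv.Perm.sign σ : ℤ) : R) * A Y)
    (B : (Fin (q + 1) → Γ) → R) (Z : Fin m → Γ) :
    (∑ V : Fin (i + 1) → Γ, ∑ W : Fin (i + 1) → Γ, (∏ k, D (V k) (W k)) *
          (A (fun j : Fin (p + 1) => if hj : (j : ℕ) < p + 1 - (i + 1) then Z ⟨j, by omega⟩ else V ⟨j - (p + 1 - (i + 1)), by omega⟩) *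
            B (fun j : Fin (q + 1) => if hj : (j : ℕ) < i + 1 then W ⟨i + 1 - 1 - j, by omega⟩ else Z ⟨p + 1 - (i + 1) + (j - (i + 1)), by omega⟩))) =
    ((-1 : R) ^ p) * ∑ x : Γ, ∑ y : Γ, D x y * (∑ V : Fin (i) → Γ, ∑ W : Fin (i) → Γ, (∏ k, D (V k) (W k)) *
          ((fun Y : Fin p → Γ => A (Fin.cons x Y)) (fun j : Fin (p) => if hj : (j : ℕ) < p - (i) then Z ⟨j, by omega⟩ else V ⟨j - (p - (i)), by omega⟩) *
            (fun Y : Fin q → Γ => B (Fin.cons y Y)) (fun j : Fin (q) => if hj : (j : ℕ) < i then W ⟨i - 1 - j, by omega⟩ else Z ⟨p - (i) + (j - (i)), by omega⟩))) := by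
  rw [sum_sum_snoc, Finset.mul_sum]
  refine Finset.sum_congr rfl fun x _ => ?_
  rw [Finset.sum_comm, Finset.mul_sum]
  refine Finset.sum_congr rfl fun y _ => ?_
  rw [Finset.mul_sum, Finset.mul_sum]
  refine Finset.sum_congr rfl fun V _ => ?_
  rw [Finset.mul_sum, Finset.mul_sum]
  refine Finset.sum_congr rfl fun W _ => ?_
  rw [argA_snoc h.1 (by omega) Z V x, argB_snoc h.1 h.2.2 Z W y, antisymm_snoc hA, Fin.prod_univ_castSucc]
  simp only [Fin.snoc_castSucc, Fin.snoc_last]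
  ring

end Index

section Regroup

variable {R : Type*} [CommRing R]

/-- The combinatorial coefficient `c(p,q,i) = (-1)^i · i! · C(p,i) · C(q,i)` vanishes for `i > p`. [cite: Salmhofer1998, Appendix B, `κ = C(m₁,i) C(m₂,i)` (render p0031:L118-L125)] -/
theorem wickCoeff_eq_zero_of_lt {p q i : ℕ} (h : p < i) :
    ((-1 : R) ^ i * ((Nat.factorial i * (Nat.choose p i * Nat.choose q i) : ℕ) : R)) = 0 := by
  rw [Nat.choose_eq_zero_of_lt h, zero_mul, mul_zero, Nat.cast_zero, mul_zero]

/-- **Pascal-type recursion of the coefficients**: one more field on the first vertex is either an external leg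
(`C(p,i+1)`) or the end of one more internal line (`q · C(q-1,i)` choices on the second vertex). [cite: Salmhofer1998, Appendix B, counting of graphs with the same value (render p0031:L118-L125, L158-L163)] -/
theorem wickCoeff_succ (p q i : ℕ) :
    ((-1 : R) ^ (i + 1) * ((Nat.factorial (i + 1) * (Nat.choose (p + 1) (i + 1) * Nat.choose (q + 1) (i + 1)) : ℕ) : R)) =
      ((-1 : R) ^ (i + 1) * ((Nat.factorial (i + 1) * (Nat.choose p (i + 1) * Nat.choose (q + 1) (i + 1)) : ℕ) : R)) -
        ((q + 1 : ℕ) : R) * ((-1 : R) ^ i * ((Nat.factorial i * (Nat.choose p i * Nat.choose q i) : ℕ) : R)) := by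
  have h := congrArg (Nat.cast : ℕ → R) (Nat.add_one_mul_choose_eq q i)
  push_cast at h ⊢
  rw [Nat.choose_succ_succ', Nat.factorial_succ]
  push_cast
  linear_combination ((-1 : R) ^ i * (Nat.factorial i : R) * (Nat.choose p i : R)) * h

variable {M : Type*} [AddCommGroup M] [Module R M]

/-- **Regrouping of the recursion** (abstract bookkeeping): if `Φ i m` is supported on
`i ≤ p + 1`, `i ≤ q + 1`, `(p+1) + (q+1) = m + 2i`, then the `(p+1, q+1)` sum of `c(p+1,q+1,i) • Φ i m` splits into
the external-leg sum (first vertex of degree `p`, monomial degree `m + 1`) minus `(q+1)` times the contracted sum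
(both vertices lose a field, one more internal line). [folklore] -/
private theorem wick_regroup_succ (p q : ℕ) (Φ : ℕ → ℕ → M)
    (hΦ : ∀ i m, ¬(i ≤ p + 1 ∧ i ≤ q + 1 ∧ p + 1 + (q + 1) = m + 2 * i) → Φ i m = 0) :
    ∑ m ∈ range (p + 1 + (q + 1) + 1), ∑ i ∈ range (p + 1 + 1),
        ((-1 : R) ^ i * ((Nat.factorial i * (Nat.choose (p + 1) i * Nat.choose (q + 1) i) : ℕ) : R)) • Φ i m =
      ∑ m ∈ range (p + (q + 1) + 1), ∑ i ∈ range (p + 1),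
          ((-1 : R) ^ i * ((Nat.factorial i * (Nat.choose p i * Nat.choose (q + 1) i) : ℕ) : R)) • Φ i (m + 1) -
        ((q + 1 : ℕ) : R) • ∑ m ∈ range (p + q + 1), ∑ i ∈ range (p + 1),
          ((-1 : R) ^ i * ((Nat.factorial i * (Nat.choose p i * Nat.choose q i) : ℕ) : R)) • Φ (i + 1) m := by
  -- Step 1: split `i = 0` / `i + 1` on the left and use the coefficient recursion
  have hL : ∀ m, ∑ i ∈ range (p + 1 + 1),
      ((-1 : R) ^ i * ((Nat.factorial i * (Nat.choose (p + 1) i * Nat.choose (q + 1) i) : ℕ) : R)) • Φ i m =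
      ∑ i ∈ range (p + 1 + 1), ((-1 : R) ^ i * ((Nat.factorial i * (Nat.choose p i * Nat.choose (q + 1) i) : ℕ) : R)) • Φ i m -
        ((q + 1 : ℕ) : R) • ∑ i ∈ range (p + 1),
          ((-1 : R) ^ i * ((Nat.factorial i * (Nat.choose p i * Nat.choose q i) : ℕ) : R)) • Φ (i + 1) m := by
    intro m
    rw [Finset.sum_range_succ' _ (p + 1), Finset.sum_range_succ' (fun i => ((-1 : R) ^ i *
      ((Nat.factorial i * (Nat.choose p i * Nat.choose (q + 1) i) : ℕ) : R)) • Φ i m) (p + 1), Finset.smul_sum]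
    simp only [wickCoeff_succ, sub_smul, Finset.sum_sub_distrib, mul_smul, pow_zero, Nat.factorial_zero,
      Nat.choose_zero_right, mul_one, Nat.cast_one, one_smul]
    abel
  simp only [hL, Finset.sum_sub_distrib, ← Finset.smul_sum]
  congr 1
  · -- external legs: shift `m ↦ m + 1`; the `m = 0` slice and the `i = p + 1` slice vanish
    rw [show p + 1 + (q + 1) + 1 = (p + (q + 1) + 1) + 1 by ring, Finset.sum_range_succ']
    have h0 : ∑ i ∈ range (p + 1 + 1),
        ((-1 : R) ^ i * ((Nat.factorial i * (Nat.choose p i * Nat.choose (q + 1) i) : ℕ) : R)) • Φ i 0 = 0 := by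
      refine Finset.sum_eq_zero fun i hi => ?_
      by_cases hip : i ≤ p
      · rw [hΦ i 0 (by omega), smul_zero]
      · rw [wickCoeff_eq_zero_of_lt (by omega), zero_smul]
    rw [h0, add_zero]
    refine Finset.sum_congr rfl fun m _ => ?_
    rw [Finset.sum_range_succ, wickCoeff_eq_zero_of_lt (Nat.lt_succ_self p), zero_smul, add_zero]
  · -- contracted lines: the two top values of `m` carry nothing
    congr 1
    rw [show p + 1 + (q + 1) + 1 = (p + q + 1) + 1 + 1 by ring, Finset.sum_range_succ, Finset.sum_range_succ]
    have h1 : ∀ m, p + q + 1 ≤ m → ∑ i ∈ range (p + 1),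
        ((-1 : R) ^ i * ((Nat.factorial i * (Nat.choose p i * Nat.choose q i) : ℕ) : R)) • Φ (i + 1) m = 0 := by
      intro m hm
      exact Finset.sum_eq_zero fun i _ => by rw [hΦ (i + 1) m (by omega), smul_zero]
    rw [h1 _ (by omega), h1 _ (by omega), add_zero, add_zero]

/-- The `q = 0` case of the regrouping: no internal line can end on an empty second vertex. [folklore] -/
private theorem wick_regroup_zero (p : ℕ) (Φ : ℕ → ℕ → M)
    (hΦ : ∀ i m, ¬(i ≤ p + 1 ∧ i ≤ 0 ∧ p + 1 + 0 = m + 2 * i) → Φ i m = 0) :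
    ∑ m ∈ range (p + 1 + 0 + 1), ∑ i ∈ range (p + 1 + 1),
        ((-1 : R) ^ i * ((Nat.factorial i * (Nat.choose (p + 1) i * Nat.choose 0 i) : ℕ) : R)) • Φ i m =
      ∑ m ∈ range (p + 0 + 1), ∑ i ∈ range (p + 1),
          ((-1 : R) ^ i * ((Nat.factorial i * (Nat.choose p i * Nat.choose 0 i) : ℕ) : R)) • Φ i (m + 1) := by
  -- only `i = 0`, `m = p + 1` survives on both sides
  have hi : ∀ (n k : ℕ) (m : ℕ), ∑ i ∈ range (k + 1),
      ((-1 : R) ^ i * ((Nat.factorial i * (Nat.choose n i * Nat.choose 0 i) : ℕ) : R)) • Φ i m = Φ 0 m := by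
    intro n k m
    rw [Finset.sum_range_succ']
    simp only [Nat.choose_zero_succ, mul_zero, Nat.cast_zero, zero_smul, Finset.sum_const_zero, zero_add, pow_zero,
      Nat.factorial_zero, Nat.choose_zero_right, Nat.cast_one, mul_one, one_smul]
  simp only [hi]
  rw [show p + 1 + 0 + 1 = (p + 0 + 1) + 1 by ring, Finset.sum_range_succ', hΦ 0 0 (by omega), add_zero]

end Regroup

section ProductFormula

variable (R : Type*) [CommRing R] [Algebra ℚ R] {Γ : Type*} [Fintype Γ] [DecidableEq Γ]

omit [Algebra ℚ R] in
/-- A presented polynomial of degree `0` is the scalar `A(∅)`. [folklore] -/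
private theorem presented_fin_zero (A : (Fin 0 → Γ) → R) : presented R A = algebraMap R _ (A default) := by
  rw [presented, Fintype.sum_unique, genProd_zero, Algebra.algebraMap_eq_smul_one]

omit [Algebra ℚ R] in
/-- Linear combinations of presentations present the linear combination. [folklore] -/
private theorem presented_sum_mul {ι : Type*} (s : Finset ι) (g : ι → R) {k : ℕ} (φ : ι → (Fin k → Γ) → R) :
    presented R (fun Z => ∑ a ∈ s, g a * φ a Z) = ∑ a ∈ s, g a • presented R (φ a) := by
  simp only [presented, Finset.sum_smul, mul_smul]
  rw [Finset.sum_comm]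
  exact Finset.sum_congr rfl fun a _ => by rw [Finset.smul_sum]

omit [Algebra ℚ R] in
/-- Sums of presentations present the sum. [folklore] -/
private theorem presented_sum {ι : Type*} (s : Finset ι) {k : ℕ} (φ : ι → (Fin k → Γ) → R) :
    presented R (fun Z => ∑ a ∈ s, φ a Z) = ∑ a ∈ s, presented R (φ a) := by
  simp only [presented, Finset.sum_smul]
  rw [Finset.sum_comm]

variable {R}

omit [Algebra ℚ R] in
/-- External-leg term of the recursion, at the level of presented polynomials. [cite: Salmhofer1998, Appendix B (render p0031:L39-L51)] -/
theorem ext_term (D : Matrix Γ Γ R) {p q i m : ℕ} (h : i ≤ p ∧ i ≤ q ∧ p + q = m + 2 * i)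
    (A : (Fin (p + 1) → Γ) → R) (B : (Fin q → Γ) → R) :
    ∑ x : Γ, gen R x * presented R (fun Z : Fin m → Γ =>
      ∑ V : Fin (i) → Γ, ∑ W : Fin (i) → Γ, (∏ k, D (V k) (W k)) *
          ((fun Y : Fin p → Γ => A (Fin.cons x Y)) (fun j : Fin (p) => if hj : (j : ℕ) < p - (i) then Z ⟨j, by omega⟩ else V ⟨j - (p - (i)), by omega⟩) *
            B (fun j : Fin (q) => if hj : (j : ℕ) < i then W ⟨i - 1 - j, by omega⟩ else Z ⟨p - (i) + (j - (i)), by omega⟩))) =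
    presented R (fun X : Fin (m + 1) → Γ =>
      ∑ V : Fin (i) → Γ, ∑ W : Fin (i) → Γ, (∏ k, D (V k) (W k)) *
          (A (fun j : Fin (p + 1) => if hj : (j : ℕ) < p + 1 - (i) then X ⟨j, by omega⟩ else V ⟨j - (p + 1 - (i)), by omega⟩) *
            B (fun j : Fin (q) => if hj : (j : ℕ) < i then W ⟨i - 1 - j, by omega⟩ else X ⟨p + 1 - (i) + (j - (i)), by omega⟩))) := by
  symm
  rw [presented_succ]
  refine Finset.sum_congr rfl fun x _ => ?_
  congr 1
  congr 1
  funext Z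
  simp only
  rw [kernel_ext D h A B (Fin.cons x Z)]
  simp only [Fin.cons_zero, Fin.tail_cons]

omit [Algebra ℚ R] in
/-- Contracted-line term of the recursion, at the level of presented polynomials. [cite: Salmhofer1998, Appendix B (render p0031:L9-L23)] -/
theorem contr_term (D : Matrix Γ Γ R) {p q i m : ℕ} (h : i ≤ p ∧ i ≤ q ∧ p + q = m + 2 * i)
    {A : (Fin (p + 1) → Γ) → R}
    (hA : ∀ (σ : Equiv.Perm (Fin (p + 1))) (Y : Fin (p + 1) → Γ), A (Y ∘ σ) = ((Equiv.Perm.sign σ : ℤ) : R) * A Y)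
    (B : (Fin (q + 1) → Γ) → R) :
    ∑ x : Γ, ∑ y : Γ, D x y • presented R (fun Z : Fin m → Γ =>
      ∑ V : Fin (i) → Γ, ∑ W : Fin (i) → Γ, (∏ k, D (V k) (W k)) *
          ((fun Y : Fin p → Γ => A (Fin.cons x Y)) (fun j : Fin (p) => if hj : (j : ℕ) < p - (i) then Z ⟨j, by omega⟩ else V ⟨j - (p - (i)), by omega⟩) *
            (fun Y : Fin q → Γ => B (Fin.cons y Y)) (fun j : Fin (q) => if hj : (j : ℕ) < i then W ⟨i - 1 - j, by omega⟩ else Z ⟨p - (i) + (j - (i)), by omega⟩))) =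
    ((-1 : R) ^ p) • presented R (fun Z : Fin m → Γ =>
      ∑ V : Fin (i + 1) → Γ, ∑ W : Fin (i + 1) → Γ, (∏ k, D (V k) (W k)) *
          (A (fun j : Fin (p + 1) => if hj : (j : ℕ) < p + 1 - (i + 1) then Z ⟨j, by omega⟩ else V ⟨j - (p + 1 - (i + 1)), by omega⟩) *
            B (fun j : Fin (q + 1) => if hj : (j : ℕ) < i + 1 then W ⟨i + 1 - 1 - j, by omega⟩ else Z ⟨p + 1 - (i + 1) + (j - (i + 1)), by omega⟩))) := by
  have hsq : ((-1 : R) ^ p) * ((-1 : R) ^ p) = 1 := by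
    rw [← pow_add, Even.neg_one_pow ⟨p, rfl⟩]
  conv_rhs =>
    arg 2
    arg 2
    ext Z
    rw [kernel_contr D h hA B Z]
  rw [show (fun Z : Fin m → Γ => ((-1 : R) ^ p) * _) = ((-1 : R) ^ p) • (fun Z : Fin m → Γ => _) from rfl,
    presented_smul, smul_smul, hsq, one_smul, presented_sum]
  refine Finset.sum_congr rfl fun x _ => ?_
  rw [presented_sum_mul]

/-- **The product of two Wick-ordered polynomials with antisymmetric coefficients, in Wick coordinates**
(Salmhofer 1998, Appendix B, (B.9)–(B.15): `i` internal lines between the two vertices, `C(p,i) C(q,i) i!`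
equal contributions, external legs `X₁` of the first and `X₂` of the second vertex, the internal legs `V` at the
end of the first and `W̃` (reversed) at the beginning of the second argument string):
`e^{Δ_D}(Ω_D⟪A⟫ · Ω_D⟪B⟫) = Σ_{m,i : p+q = m+2i} (-1)^i i! C(p,i) C(q,i) ⟪X ↦ Σ_{V,W} ∏_k D(V_k,W_k) A(X₁,V) B(W̃,X₂)⟫`. [cite: Salmhofer1998, Appendix B, (B.9)-(B.15): `Σ_(L ⊂ M₁×M₂)`, `𝓛(B₁,B₂)`, `H(i,b,π)`, `κ_(m₁m₂i)` (render p0030:L144 - p0031:L125)] -/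
theorem gaussConv_wickOrder_presented_mul {D : Matrix Γ Γ R} (hD : D.transpose = -D) :
    ∀ (p q : ℕ) (A : (Fin p → Γ) → R)
      (_hA : ∀ (σ : Equiv.Perm (Fin p)) (Y : Fin p → Γ), A (Y ∘ σ) = ((Equiv.Perm.sign σ : ℤ) : R) * A Y)
      (B : (Fin q → Γ) → R)
      (_hB : ∀ (σ : Equiv.Perm (Fin q)) (Y : Fin q → Γ), B (Y ∘ σ) = ((Equiv.Perm.sign σ : ℤ) : R) * B Y),
      gaussConv R D (wickOrder R D (presented R A) * wickOrder R D (presented R B)) =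
        ∑ m ∈ range (p + (q) + 1), ∑ i ∈ range (p + 1),
          if h : i ≤ p ∧ i ≤ q ∧ p + (q) = m + 2 * i then
            ((-1 : R) ^ (i) * ((Nat.factorial (i) * (Nat.choose (p) (i) * Nat.choose (q) (i)) : ℕ) : R)) •
              presented R (fun X : Fin m → Γ => ∑ V : Fin (i) → Γ, ∑ W : Fin (i) → Γ, (∏ k, D (V k) (W k)) *
          (A (fun j : Fin (p) => if hj : (j : ℕ) < p - (i) then X ⟨j, by omega⟩ else V ⟨j - (p - (i)), by omega⟩) *
            B (fun j : Fin (q) => if hj : (j : ℕ) < i then W ⟨i - 1 - j, by omega⟩ else X ⟨p - (i) + (j - (i)), by omega⟩)))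
          else 0 := by
  intro p
  induction p with
  | zero =>
    intro q A hA B hB
    -- the first factor is the scalar `A(∅)`
    rw [presented_fin_zero, wickOrder_algebraMap, Algebra.algebraMap_eq_smul_one, smul_mul_assoc, one_mul, map_smul,
      gaussConv_wickOrder, Finset.sum_eq_single_of_mem q (mem_range.2 (by omega))
        (fun m _ hm => by rw [Finset.sum_range_one, dif_neg (by omega)])]
    rw [Finset.sum_range_one, dif_pos (by omega)]
    simp only [pow_zero, Nat.factorial_zero, Nat.choose_zero_right, mul_one, Nat.cast_one, one_smul]
    rw [← presented_smul]
    congr 1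
    funext X
    rw [Fintype.sum_unique, Fintype.sum_unique, Fintype.prod_empty, one_mul, Pi.smul_apply, smul_eq_mul]
    congr 1
    congr 1
    funext j
    rw [dif_neg (by omega)]
    congr 1
    ext
    simp
  | succ p ih =>
    intro q A hA B hB
    rw [presented_succ R A, map_sum, Finset.sum_mul, map_sum]
    have hx : ∀ x : Γ,
        gaussConv R D (wickOrder R D (gen R x * presented R (fun Y : Fin p → Γ => A (Fin.cons x Y))) * wickOrder R D (presented R B)) =
          gen R x * (∑ m ∈ range (p + (q) + 1), ∑ i ∈ range (p + 1),
          if h : i ≤ p ∧ i ≤ q ∧ p + (q) = m + 2 * i then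
            ((-1 : R) ^ (i) * ((Nat.factorial (i) * (Nat.choose (p) (i) * Nat.choose (q) (i)) : ℕ) : R)) •
              presented R (fun X : Fin m → Γ => ∑ V : Fin (i) → Γ, ∑ W : Fin (i) → Γ, (∏ k, D (V k) (W k)) *
          ((fun Y : Fin p → Γ => A (Fin.cons x Y)) (fun j : Fin (p) => if hj : (j : ℕ) < p - (i) then X ⟨j, by omega⟩ else V ⟨j - (p - (i)), by omega⟩) *
            B (fun j : Fin (q) => if hj : (j : ℕ) < i then W ⟨i - 1 - j, by omega⟩ else X ⟨p - (i) + (j - (i)), by omega⟩)))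
          else 0) -
          ((-1 : R) ^ p) • ∑ y : Γ, D x y • gaussConv R D (wickOrder R D (presented R (fun Y : Fin p → Γ => A (Fin.cons x Y))) *
            wickOrder R D (grassmannDeriv R y (presented R B))) := by
      intro x
      rw [gaussConv_wickOrder_gen_mul_mul R hD x _ _ (involute_wickOrder_presented R D _),
        ih q _ (antisymm_cons R hA x) B hB]
    simp only [hx, Finset.sum_sub_distrib]
    -- external legs
    have hExt : ∑ x : Γ, gen R x * (∑ m ∈ range (p + (q) + 1), ∑ i ∈ range (p + 1),
          if h : i ≤ p ∧ i ≤ q ∧ p + (q) = m + 2 * i then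
            ((-1 : R) ^ (i) * ((Nat.factorial (i) * (Nat.choose (p) (i) * Nat.choose (q) (i)) : ℕ) : R)) •
              presented R (fun X : Fin m → Γ => ∑ V : Fin (i) → Γ, ∑ W : Fin (i) → Γ, (∏ k, D (V k) (W k)) *
          ((fun Y : Fin p → Γ => A (Fin.cons x Y)) (fun j : Fin (p) => if hj : (j : ℕ) < p - (i) then X ⟨j, by omega⟩ else V ⟨j - (p - (i)), by omega⟩) *
            B (fun j : Fin (q) => if hj : (j : ℕ) < i then W ⟨i - 1 - j, by omega⟩ else X ⟨p - (i) + (j - (i)), by omega⟩)))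
          else 0) =
        ∑ m ∈ range (p + (q) + 1), ∑ i ∈ range (p + 1),
          if h : i ≤ p ∧ i ≤ q ∧ p + (q) = m + 2 * i then
            ((-1 : R) ^ (i) * ((Nat.factorial (i) * (Nat.choose (p) (i) * Nat.choose (q) (i)) : ℕ) : R)) •
              presented R (fun X : Fin (m + 1) → Γ => ∑ V : Fin (i) → Γ, ∑ W : Fin (i) → Γ, (∏ k, D (V k) (W k)) *
          (A (fun j : Fin (p + 1) => if hj : (j : ℕ) < p + 1 - (i) then X ⟨j, by omega⟩ else V ⟨j - (p + 1 - (i)), by omega⟩) *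
            B (fun j : Fin (q) => if hj : (j : ℕ) < i then W ⟨i - 1 - j, by omega⟩ else X ⟨p + 1 - (i) + (j - (i)), by omega⟩)))
          else 0 := by
      simp only [Finset.mul_sum]
      rw [Finset.sum_comm]
      refine Finset.sum_congr rfl fun m _ => ?_
      rw [Finset.sum_comm]
      refine Finset.sum_congr rfl fun i _ => ?_
      by_cases hc : i ≤ p ∧ i ≤ q ∧ p + q = m + 2 * i
      · simp only [dif_pos hc, mul_smul_comm, ← Finset.smul_sum, ext_term D hc A B]
      · simp only [dif_neg hc, mul_zero, Finset.sum_const_zero]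
    rw [hExt]
    cases q with
    | zero =>
      have h0 : ∀ y : Γ, grassmannDeriv R y (presented R B) = 0 := fun y => by
        rw [presented_fin_zero, grassmannDeriv_algebraMap]
      simp only [h0, map_zero, mul_zero, smul_zero, Finset.sum_const_zero, sub_zero]
      -- both sides in the form `c • Φ`
      have hG : ∀ m i : ℕ, (if h : i ≤ p + 1 ∧ i ≤ 0 ∧ p + 1 + (0) = m + 2 * i then
            ((-1 : R) ^ (i) * ((Nat.factorial (i) * (Nat.choose (p + 1) (i) * Nat.choose (0) (i)) : ℕ) : R)) •
              presented R (fun X : Fin m → Γ => ∑ V : Fin (i) → Γ, ∑ W : Fin (i) → Γ, (∏ k, D (V k) (W k)) *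
          (A (fun j : Fin (p + 1) => if hj : (j : ℕ) < p + 1 - (i) then X ⟨j, by omega⟩ else V ⟨j - (p + 1 - (i)), by omega⟩) *
            B (fun j : Fin (0) => if hj : (j : ℕ) < i then W ⟨i - 1 - j, by omega⟩ else X ⟨p + 1 - (i) + (j - (i)), by omega⟩)))
          else 0) = ((-1 : R) ^ (i) * ((Nat.factorial (i) * (Nat.choose (p + 1) (i) * Nat.choose (0) (i)) : ℕ) : R)) • (if h : i ≤ p + 1 ∧ i ≤ 0 ∧ p + 1 + (0) = m + 2 * (i) then
              presented R (fun X : Fin (m) → Γ => ∑ V : Fin (i) → Γ, ∑ W : Fin (i) → Γ, (∏ k, D (V k) (W k)) *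
          (A (fun j : Fin (p + 1) => if hj : (j : ℕ) < p + 1 - (i) then X ⟨j, by omega⟩ else V ⟨j - (p + 1 - (i)), by omega⟩) *
            B (fun j : Fin (0) => if hj : (j : ℕ) < i then W ⟨i - 1 - j, by omega⟩ else X ⟨p + 1 - (i) + (j - (i)), by omega⟩)))
            else 0) := by
        intro m i
        by_cases hc : i ≤ p + 1 ∧ i ≤ 0 ∧ p + 1 + (0) = m + 2 * i
        · rw [dif_pos hc, dif_pos hc]
        · rw [dif_neg hc, dif_neg hc, smul_zero]
      have hE : ∀ m i : ℕ, (if h : i ≤ p ∧ i ≤ 0 ∧ p + (0) = m + 2 * i then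
            ((-1 : R) ^ (i) * ((Nat.factorial (i) * (Nat.choose (p) (i) * Nat.choose (0) (i)) : ℕ) : R)) •
              presented R (fun X : Fin (m + 1) → Γ => ∑ V : Fin (i) → Γ, ∑ W : Fin (i) → Γ, (∏ k, D (V k) (W k)) *
          (A (fun j : Fin (p + 1) => if hj : (j : ℕ) < p + 1 - (i) then X ⟨j, by omega⟩ else V ⟨j - (p + 1 - (i)), by omega⟩) *
            B (fun j : Fin (0) => if hj : (j : ℕ) < i then W ⟨i - 1 - j, by omega⟩ else X ⟨p + 1 - (i) + (j - (i)), by omega⟩)))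
          else 0) = ((-1 : R) ^ (i) * ((Nat.factorial (i) * (Nat.choose (p) (i) * Nat.choose (0) (i)) : ℕ) : R)) • (if h : i ≤ p + 1 ∧ i ≤ 0 ∧ p + 1 + (0) = m + 1 + 2 * (i) then
              presented R (fun X : Fin (m + 1) → Γ => ∑ V : Fin (i) → Γ, ∑ W : Fin (i) → Γ, (∏ k, D (V k) (W k)) *
          (A (fun j : Fin (p + 1) => if hj : (j : ℕ) < p + 1 - (i) then X ⟨j, by omega⟩ else V ⟨j - (p + 1 - (i)), by omega⟩) *
            B (fun j : Fin (0) => if hj : (j : ℕ) < i then W ⟨i - 1 - j, by omega⟩ else X ⟨p + 1 - (i) + (j - (i)), by omega⟩)))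
            else 0) := by
        intro m i
        by_cases hc : i ≤ p ∧ i ≤ 0 ∧ p + (0) = m + 2 * i
        · rw [dif_pos hc, dif_pos (by omega)]
        · rw [dif_neg hc]
          by_cases hc' : i ≤ p + 1 ∧ i ≤ 0 ∧ p + 1 + (0) = m + 1 + 2 * i
          · rw [dif_pos hc', wickCoeff_eq_zero_of_lt (show p < i by omega), zero_smul]
          · rw [dif_neg hc', smul_zero]
      simp only [hG, hE]
      exact (wick_regroup_zero (R := R) p (fun i m => (if h : i ≤ p + 1 ∧ i ≤ 0 ∧ p + 1 + (0) = m + 2 * (i) then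
              presented R (fun X : Fin (m) → Γ => ∑ V : Fin (i) → Γ, ∑ W : Fin (i) → Γ, (∏ k, D (V k) (W k)) *
          (A (fun j : Fin (p + 1) => if hj : (j : ℕ) < p + 1 - (i) then X ⟨j, by omega⟩ else V ⟨j - (p + 1 - (i)), by omega⟩) *
            B (fun j : Fin (0) => if hj : (j : ℕ) < i then W ⟨i - 1 - j, by omega⟩ else X ⟨p + 1 - (i) + (j - (i)), by omega⟩)))
            else 0))
        (fun i m hn => dif_neg hn)).symm
    | succ q' =>
      have hdB : ∀ y : Γ, grassmannDeriv R y (presented R B) =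
          ((q' + 1 : ℕ) : R) • presented R (fun Z : Fin q' → Γ => B (Fin.cons y Z)) := grassmannDeriv_presented R B hB
      have hy : ∀ x y : Γ, gaussConv R D (wickOrder R D (presented R (fun Y : Fin p → Γ => A (Fin.cons x Y))) *
          wickOrder R D (grassmannDeriv R y (presented R B))) =
          ((q' + 1 : ℕ) : R) • (∑ m ∈ range (p + (q') + 1), ∑ i ∈ range (p + 1),
          if h : i ≤ p ∧ i ≤ q' ∧ p + (q') = m + 2 * i then
            ((-1 : R) ^ (i) * ((Nat.factorial (i) * (Nat.choose (p) (i) * Nat.choose (q') (i)) : ℕ) : R)) •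
              presented R (fun X : Fin m → Γ => ∑ V : Fin (i) → Γ, ∑ W : Fin (i) → Γ, (∏ k, D (V k) (W k)) *
          ((fun Y : Fin p → Γ => A (Fin.cons x Y)) (fun j : Fin (p) => if hj : (j : ℕ) < p - (i) then X ⟨j, by omega⟩ else V ⟨j - (p - (i)), by omega⟩) *
            (fun Y : Fin q' → Γ => B (Fin.cons y Y)) (fun j : Fin (q') => if hj : (j : ℕ) < i then W ⟨i - 1 - j, by omega⟩ else X ⟨p - (i) + (j - (i)), by omega⟩)))
          else 0) := by
        intro x y
        rw [hdB, map_smul, mul_smul_comm, map_smul, ih q' _ (antisymm_cons R hA x) _ (antisymm_cons R hB y)]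
      simp only [hy]
      -- contracted lines, termwise
      have hContr : ∑ x : Γ, ((-1 : R) ^ p) • ∑ y : Γ, D x y • (((q' + 1 : ℕ) : R) • (∑ m ∈ range (p + (q') + 1), ∑ i ∈ range (p + 1),
          if h : i ≤ p ∧ i ≤ q' ∧ p + (q') = m + 2 * i then
            ((-1 : R) ^ (i) * ((Nat.factorial (i) * (Nat.choose (p) (i) * Nat.choose (q') (i)) : ℕ) : R)) •
              presented R (fun X : Fin m → Γ => ∑ V : Fin (i) → Γ, ∑ W : Fin (i) → Γ, (∏ k, D (V k) (W k)) *
          ((fun Y : Fin p → Γ => A (Fin.cons x Y)) (fun j : Fin (p) => if hj : (j : ℕ) < p - (i) then X ⟨j, by omega⟩ else V ⟨j - (p - (i)), by omega⟩) *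
            (fun Y : Fin q' → Γ => B (Fin.cons y Y)) (fun j : Fin (q') => if hj : (j : ℕ) < i then W ⟨i - 1 - j, by omega⟩ else X ⟨p - (i) + (j - (i)), by omega⟩)))
          else 0)) =
          ∑ m ∈ range (p + (q') + 1), ∑ i ∈ range (p + 1),
            if h : i ≤ p ∧ i ≤ q' ∧ p + (q') = m + 2 * i then
              ((-1 : R) ^ p) • ((((q' + 1 : ℕ) : R)) • (((-1 : R) ^ (i) * ((Nat.factorial (i) * (Nat.choose (p) (i) * Nat.choose (q') (i)) : ℕ) : R)) •
                (((-1 : R) ^ p) • presented R (fun X : Fin m → Γ => ∑ V : Fin (i + 1) → Γ, ∑ W : Fin (i + 1) → Γ, (∏ k, D (V k) (W k)) *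
          (A (fun j : Fin (p + 1) => if hj : (j : ℕ) < p + 1 - (i + 1) then X ⟨j, by omega⟩ else V ⟨j - (p + 1 - (i + 1)), by omega⟩) *
            B (fun j : Fin (q' + 1) => if hj : (j : ℕ) < i + 1 then W ⟨i + 1 - 1 - j, by omega⟩ else X ⟨p + 1 - (i + 1) + (j - (i + 1)), by omega⟩))))))
            else 0 := by
        simp only [Finset.smul_sum]
        simp_rw [Finset.sum_comm (s := (univ : Finset Γ)) (t := range (p + (q') + 1)),
          Finset.sum_comm (s := (univ : Finset Γ)) (t := range (p + 1))]
        refine Finset.sum_congr rfl fun m _ => Finset.sum_congr rfl fun i _ => ?_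
        by_cases hc : i ≤ p ∧ i ≤ q' ∧ p + (q') = m + 2 * i
        · simp only [dif_pos hc, smul_smul]
          simp only [mul_comm (D _ _) _, mul_assoc]
          simp only [mul_smul, ← Finset.smul_sum]
          rw [contr_term D hc hA B]
        · simp only [dif_neg hc, smul_zero, Finset.sum_const_zero]
      rw [hContr]
      have hsq : ((-1 : R) ^ p) * ((-1 : R) ^ p) = 1 := by
        rw [← pow_add, Even.neg_one_pow ⟨p, rfl⟩]
      -- all three double sums in the form `c • Φ`
      have hG : ∀ m i : ℕ, (if h : i ≤ p + 1 ∧ i ≤ q' + 1 ∧ p + 1 + (q' + 1) = m + 2 * i then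
            ((-1 : R) ^ (i) * ((Nat.factorial (i) * (Nat.choose (p + 1) (i) * Nat.choose (q' + 1) (i)) : ℕ) : R)) •
              presented R (fun X : Fin m → Γ => ∑ V : Fin (i) → Γ, ∑ W : Fin (i) → Γ, (∏ k, D (V k) (W k)) *
          (A (fun j : Fin (p + 1) => if hj : (j : ℕ) < p + 1 - (i) then X ⟨j, by omega⟩ else V ⟨j - (p + 1 - (i)), by omega⟩) *
            B (fun j : Fin (q' + 1) => if hj : (j : ℕ) < i then W ⟨i - 1 - j, by omega⟩ else X ⟨p + 1 - (i) + (j - (i)), by omega⟩)))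
          else 0) = ((-1 : R) ^ (i) * ((Nat.factorial (i) * (Nat.choose (p + 1) (i) * Nat.choose (q' + 1) (i)) : ℕ) : R)) • (if h : i ≤ p + 1 ∧ i ≤ q' + 1 ∧ p + 1 + (q' + 1) = m + 2 * (i) then
              presented R (fun X : Fin (m) → Γ => ∑ V : Fin (i) → Γ, ∑ W : Fin (i) → Γ, (∏ k, D (V k) (W k)) *
          (A (fun j : Fin (p + 1) => if hj : (j : ℕ) < p + 1 - (i) then X ⟨j, by omega⟩ else V ⟨j - (p + 1 - (i)), by omega⟩) *
            B (fun j : Fin (q' + 1) => if hj : (j : ℕ) < i then W ⟨i - 1 - j, by omega⟩ else X ⟨p + 1 - (i) + (j - (i)), by omega⟩)))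
            else 0) := by
        intro m i
        by_cases hc : i ≤ p + 1 ∧ i ≤ q' + 1 ∧ p + 1 + (q' + 1) = m + 2 * i
        · rw [dif_pos hc, dif_pos hc]
        · rw [dif_neg hc, dif_neg hc, smul_zero]
      have hE : ∀ m i : ℕ, (if h : i ≤ p ∧ i ≤ q' + 1 ∧ p + (q' + 1) = m + 2 * i then
            ((-1 : R) ^ (i) * ((Nat.factorial (i) * (Nat.choose (p) (i) * Nat.choose (q' + 1) (i)) : ℕ) : R)) •
              presented R (fun X : Fin (m + 1) → Γ => ∑ V : Fin (i) → Γ, ∑ W : Fin (i) → Γ, (∏ k, D (V k) (W k)) *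
          (A (fun j : Fin (p + 1) => if hj : (j : ℕ) < p + 1 - (i) then X ⟨j, by omega⟩ else V ⟨j - (p + 1 - (i)), by omega⟩) *
            B (fun j : Fin (q' + 1) => if hj : (j : ℕ) < i then W ⟨i - 1 - j, by omega⟩ else X ⟨p + 1 - (i) + (j - (i)), by omega⟩)))
          else 0) = ((-1 : R) ^ (i) * ((Nat.factorial (i) * (Nat.choose (p) (i) * Nat.choose (q' + 1) (i)) : ℕ) : R)) • (if h : i ≤ p + 1 ∧ i ≤ q' + 1 ∧ p + 1 + (q' + 1) = m + 1 + 2 * (i) then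
              presented R (fun X : Fin (m + 1) → Γ => ∑ V : Fin (i) → Γ, ∑ W : Fin (i) → Γ, (∏ k, D (V k) (W k)) *
          (A (fun j : Fin (p + 1) => if hj : (j : ℕ) < p + 1 - (i) then X ⟨j, by omega⟩ else V ⟨j - (p + 1 - (i)), by omega⟩) *
            B (fun j : Fin (q' + 1) => if hj : (j : ℕ) < i then W ⟨i - 1 - j, by omega⟩ else X ⟨p + 1 - (i) + (j - (i)), by omega⟩)))
            else 0) := by
        intro m i
        by_cases hc : i ≤ p ∧ i ≤ q' + 1 ∧ p + (q' + 1) = m + 2 * i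
        · rw [dif_pos hc, dif_pos (by omega)]
        · rw [dif_neg hc]
          by_cases hc' : i ≤ p + 1 ∧ i ≤ q' + 1 ∧ p + 1 + (q' + 1) = m + 1 + 2 * i
          · rw [dif_pos hc', wickCoeff_eq_zero_of_lt (show p < i by omega), zero_smul]
          · rw [dif_neg hc', smul_zero]
      have hC : ∀ m i : ℕ, (if h : i ≤ p ∧ i ≤ q' ∧ p + (q') = m + 2 * i then
              ((-1 : R) ^ p) • ((((q' + 1 : ℕ) : R)) • (((-1 : R) ^ (i) * ((Nat.factorial (i) * (Nat.choose (p) (i) * Nat.choose (q') (i)) : ℕ) : R)) •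
                (((-1 : R) ^ p) • presented R (fun X : Fin m → Γ => ∑ V : Fin (i + 1) → Γ, ∑ W : Fin (i + 1) → Γ, (∏ k, D (V k) (W k)) *
          (A (fun j : Fin (p + 1) => if hj : (j : ℕ) < p + 1 - (i + 1) then X ⟨j, by omega⟩ else V ⟨j - (p + 1 - (i + 1)), by omega⟩) *
            B (fun j : Fin (q' + 1) => if hj : (j : ℕ) < i + 1 then W ⟨i + 1 - 1 - j, by omega⟩ else X ⟨p + 1 - (i + 1) + (j - (i + 1)), by omega⟩))))))
            else 0) = ((q' + 1 : ℕ) : R) • (((-1 : R) ^ (i) * ((Nat.factorial (i) * (Nat.choose (p) (i) * Nat.choose (q') (i)) : ℕ) : R)) • (if h : i + 1 ≤ p + 1 ∧ i + 1 ≤ q' + 1 ∧ p + 1 + (q' + 1) = m + 2 * (i + 1) then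
              presented R (fun X : Fin (m) → Γ => ∑ V : Fin (i + 1) → Γ, ∑ W : Fin (i + 1) → Γ, (∏ k, D (V k) (W k)) *
          (A (fun j : Fin (p + 1) => if hj : (j : ℕ) < p + 1 - (i + 1) then X ⟨j, by omega⟩ else V ⟨j - (p + 1 - (i + 1)), by omega⟩) *
            B (fun j : Fin (q' + 1) => if hj : (j : ℕ) < i + 1 then W ⟨i + 1 - 1 - j, by omega⟩ else X ⟨p + 1 - (i + 1) + (j - (i + 1)), by omega⟩)))
            else 0)) := by
        intro m i
        by_cases hc : i ≤ p ∧ i ≤ q' ∧ p + (q') = m + 2 * i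
        · rw [dif_pos hc, dif_pos (by omega), smul_comm ((-1 : R) ^ p) (((q' + 1 : ℕ) : R)),
            smul_comm ((-1 : R) ^ p) _, smul_smul ((-1 : R) ^ p), hsq, one_smul]
        · rw [dif_neg hc, dif_neg (by omega), smul_zero, smul_zero]
      simp only [hG, hE, hC, ← Finset.smul_sum]
      exact (wick_regroup_succ (R := R) p q' (fun i m => (if h : i ≤ p + 1 ∧ i ≤ q' + 1 ∧ p + 1 + (q' + 1) = m + 2 * (i) then
              presented R (fun X : Fin (m) → Γ => ∑ V : Fin (i) → Γ, ∑ W : Fin (i) → Γ, (∏ k, D (V k) (W k)) *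
          (A (fun j : Fin (p + 1) => if hj : (j : ℕ) < p + 1 - (i) then X ⟨j, by omega⟩ else V ⟨j - (p + 1 - (i)), by omega⟩) *
            B (fun j : Fin (q' + 1) => if hj : (j : ℕ) < i then W ⟨i - 1 - j, by omega⟩ else X ⟨p + 1 - (i) + (j - (i)), by omega⟩)))
            else 0))
        (fun i m hn => dif_neg hn)).symm

end ProductFormula

section Pairing

variable (R : Type*) [CommRing R] [Algebra ℚ R] {Γ : Type*} [Fintype Γ] [DecidableEq Γ]

omit [Algebra ℚ R] [DecidableEq Γ] in
/-- `grassmannDerivPairing` is additive in both arguments (finite sums). [cite: Salmhofer1998, (3.16) (render p0012:L47-L56)] -/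
theorem grassmannDerivPairing_sum_sum (C : Matrix Γ Γ R) {ι κ : Type*} (s : Finset ι) (t : Finset κ)
    (a : ι → GrassmannAlgebra R Γ) (b : κ → GrassmannAlgebra R Γ) :
    grassmannDerivPairing R C (∑ u ∈ s, a u) (∑ v ∈ t, b v) = ∑ u ∈ s, ∑ v ∈ t, grassmannDerivPairing R C (a u) (b v) := by
  simp only [grassmannDerivPairing_apply, map_sum, Finset.sum_mul, Finset.mul_sum, Finset.smul_sum]
  simp_rw [Finset.sum_comm (s := (univ : Finset Γ)) (t := t), Finset.sum_comm (s := (univ : Finset Γ)) (t := s)]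
  exact Finset.sum_comm

/-- The derivative of a Wick-ordered presented antisymmetric polynomial:
`∂_X Ω_D⟪A⟫ = (p+1) Ω_D⟪A(X, ·)⟫`. [cite: Salmhofer1998, Appendix B, first display (render p0030:L22-L58)] -/
theorem grassmannDeriv_wickOrder_presented (D : Matrix Γ Γ R) {p : ℕ} (A : (Fin (p + 1) → Γ) → R)
    (hA : ∀ (σ : Equiv.Perm (Fin (p + 1))) (Y : Fin (p + 1) → Γ), A (Y ∘ σ) = ((Equiv.Perm.sign σ : ℤ) : R) * A Y)
    (X : Γ) :
    grassmannDeriv R X (wickOrder R D (presented R A)) =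
      ((p + 1 : ℕ) : R) • wickOrder R D (presented R (fun Z : Fin p → Γ => A (Fin.cons X Z))) := by
  rw [wickOrder_def, grassmannDeriv_gaussConv, grassmannDeriv_presented R A hA X, map_smul]

/-- **Salmhofer's bilinear term on two Wick-ordered polynomials** (Appendix B: the two derivatives fix one line
`C'(x,y)` between the vertices; the product formula supplies the other `i` lines):
`(δΩ⟪A⟫/δψ, C' δΩ⟪B⟫/δψ) = Σ_{m,i} (p+1)(q+1) c(p,q,i) Ω⟪Z ↦ Σ_{x,y} C'(x,y) K_i(A(x,·), B(y,·))(Z)⟫`. [cite: Salmhofer1998, (3.16)-(3.17) (render p0012:L47-L63); Appendix B, `𝒴_(r₁,m₁,r₂,m₂)` and `P(X,ψ)` (render p0030:L1-L27)] -/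
theorem grassmannDerivPairing_wickOrder_presented {D : Matrix Γ Γ R} (hD : D.transpose = -D) (C' : Matrix Γ Γ R)
    {p q : ℕ} (A : (Fin (p + 1) → Γ) → R)
    (hA : ∀ (σ : Equiv.Perm (Fin (p + 1))) (Y : Fin (p + 1) → Γ), A (Y ∘ σ) = ((Equiv.Perm.sign σ : ℤ) : R) * A Y)
    (B : (Fin (q + 1) → Γ) → R)
    (hB : ∀ (σ : Equiv.Perm (Fin (q + 1))) (Y : Fin (q + 1) → Γ), B (Y ∘ σ) = ((Equiv.Perm.sign σ : ℤ) : R) * B Y) :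
    grassmannDerivPairing R C' (wickOrder R D (presented R A)) (wickOrder R D (presented R B)) =
      ∑ m ∈ range (p + (q) + 1), ∑ i ∈ range (p + 1),
        if h : i ≤ p ∧ i ≤ q ∧ p + (q) = m + 2 * i then
          (((p + 1) * (q + 1) : ℕ) : R) • (((-1 : R) ^ (i) * ((Nat.factorial (i) * (Nat.choose (p) (i) * Nat.choose (q) (i)) : ℕ) : R)) •
            wickOrder R D (presented R (fun Z : Fin m → Γ => ∑ x : Γ, ∑ y : Γ, C' x y *
              (∑ V : Fin (i) → Γ, ∑ W : Fin (i) → Γ, (∏ k, D (V k) (W k)) *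
          ((fun Y : Fin p → Γ => A (Fin.cons x Y)) (fun j : Fin (p) => if hj : (j : ℕ) < p - (i) then Z ⟨j, by omega⟩ else V ⟨j - (p - (i)), by omega⟩) *
            (fun Y : Fin q → Γ => B (Fin.cons y Y)) (fun j : Fin (q) => if hj : (j : ℕ) < i then W ⟨i - 1 - j, by omega⟩ else Z ⟨p - (i) + (j - (i)), by omega⟩))))))
        else 0 := by
  -- the two derivatives and the product formula
  have hprod : ∀ x y : Γ, wickOrder R D (presented R (fun Y : Fin p → Γ => A (Fin.cons x Y))) * wickOrder R D (presented R (fun Y : Fin q → Γ => B (Fin.cons y Y))) =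
      wickOrder R D (∑ m ∈ range (p + (q) + 1), ∑ i ∈ range (p + 1),
          if h : i ≤ p ∧ i ≤ q ∧ p + (q) = m + 2 * i then
            ((-1 : R) ^ (i) * ((Nat.factorial (i) * (Nat.choose (p) (i) * Nat.choose (q) (i)) : ℕ) : R)) •
              presented R (fun X : Fin m → Γ => ∑ V : Fin (i) → Γ, ∑ W : Fin (i) → Γ, (∏ k, D (V k) (W k)) *
          ((fun Y : Fin p → Γ => A (Fin.cons x Y)) (fun j : Fin (p) => if hj : (j : ℕ) < p - (i) then X ⟨j, by omega⟩ else V ⟨j - (p - (i)), by omega⟩) *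
            (fun Y : Fin q → Γ => B (Fin.cons y Y)) (fun j : Fin (q) => if hj : (j : ℕ) < i then W ⟨i - 1 - j, by omega⟩ else X ⟨p - (i) + (j - (i)), by omega⟩)))
          else 0) := by
    intro x y
    rw [← wickOrder_gaussConv R D (_ * _), gaussConv_wickOrder_presented_mul hD p q _ (antisymm_cons R hA x) _
      (antisymm_cons R hB y)]
  have h1 : grassmannDerivPairing R C' (wickOrder R D (presented R A)) (wickOrder R D (presented R B)) =
      ∑ x : Γ, ∑ y : Γ, (((p + 1) * (q + 1) : ℕ) : R) • (C' x y • (wickOrder R D (presented R (fun Y : Fin p → Γ => A (Fin.cons x Y))) *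
        wickOrder R D (presented R (fun Y : Fin q → Γ => B (Fin.cons y Y))))) := by
    rw [grassmannDerivPairing_apply]
    refine Finset.sum_congr rfl fun x _ => Finset.sum_congr rfl fun y _ => ?_
    rw [grassmannDeriv_wickOrder_presented R D A hA, grassmannDeriv_wickOrder_presented R D B hB, smul_mul_smul_comm,
      smul_smul, smul_smul, Nat.cast_mul]
    congr 1
    ring
  rw [h1]
  simp only [hprod, map_sum, Finset.smul_sum]
  simp_rw [Finset.sum_comm (s := (univ : Finset Γ)) (t := range (p + (q) + 1)),
    Finset.sum_comm (s := (univ : Finset Γ)) (t := range (p + 1))]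
  refine Finset.sum_congr rfl fun m _ => Finset.sum_congr rfl fun i _ => ?_
  by_cases hc : i ≤ p ∧ i ≤ q ∧ p + (q) = m + 2 * i
  · simp only [dif_pos hc]
    have hR : presented R (fun Z : Fin m → Γ => ∑ x : Γ, ∑ y : Γ, C' x y * (∑ V : Fin (i) → Γ, ∑ W : Fin (i) → Γ, (∏ k, D (V k) (W k)) *
          ((fun Y : Fin p → Γ => A (Fin.cons x Y)) (fun j : Fin (p) => if hj : (j : ℕ) < p - (i) then Z ⟨j, by omega⟩ else V ⟨j - (p - (i)), by omega⟩) *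
            (fun Y : Fin q → Γ => B (Fin.cons y Y)) (fun j : Fin (q) => if hj : (j : ℕ) < i then W ⟨i - 1 - j, by omega⟩ else Z ⟨p - (i) + (j - (i)), by omega⟩)))) =
        ∑ x : Γ, ∑ y : Γ, C' x y • presented R (fun Z : Fin m → Γ => ∑ V : Fin (i) → Γ, ∑ W : Fin (i) → Γ, (∏ k, D (V k) (W k)) *
          ((fun Y : Fin p → Γ => A (Fin.cons x Y)) (fun j : Fin (p) => if hj : (j : ℕ) < p - (i) then Z ⟨j, by omega⟩ else V ⟨j - (p - (i)), by omega⟩) *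
            (fun Y : Fin q → Γ => B (Fin.cons y Y)) (fun j : Fin (q) => if hj : (j : ℕ) < i then W ⟨i - 1 - j, by omega⟩ else Z ⟨p - (i) + (j - (i)), by omega⟩))) := by
      rw [presented_sum]
      exact Finset.sum_congr rfl fun x _ => presented_sum_mul R _ _ _
    rw [hR]
    simp only [map_sum, map_smul, Finset.smul_sum]
    refine Finset.sum_congr rfl fun x _ => Finset.sum_congr rfl fun y _ => ?_
    simp only [smul_smul]
    congr 1
    ring
  · simp only [dif_neg hc, map_zero, smul_zero, Finset.sum_const_zero]

end Pairing

section DetCollapse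

variable {Γ : Type*} [Fintype Γ] [DecidableEq Γ]

omit [DecidableEq Γ] in
/-- Relabelling the internal legs by a permutation does not change a sum over all leg strings. [folklore] -/
private theorem sum_comp_perm_arg {M : Type*} [AddCommMonoid M] {n : ℕ} (σ : Equiv.Perm (Fin n)) (f : (Fin n → Γ) → M) :
    ∑ V : Fin n → Γ, f (V ∘ σ) = ∑ V : Fin n → Γ, f V :=
  Fintype.sum_bijective (fun V : Fin n → Γ => V ∘ σ)
    (Function.bijective_iff_has_inverse.2 ⟨fun Z => Z ∘ σ.symm, fun V => by funext k; simp, fun Z => by funext k; simp⟩)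
    _ _ fun _ => rfl

omit [DecidableEq Γ] in
/-- **Determinant collapse** (Salmhofer 1998, Appendix B: "the sum over permutations `π` gives the determinant",
read backwards; and the `i` equal column-replacement terms of `∂_t det`): against a function antisymmetric in the
`V`-legs and in the `W`-legs separately, `Σ_{V,W} ∂det[𝒟_D^{(i+1)}(V,W)](𝒟_E) Φ(V,W)` is `(i+1)·(i+1)!` times the
single term in which the LAST line carries `E` and the other `i` lines carry `D` diagonally. [cite: Salmhofer1998, Appendix B, "the sum over permutations `π` gives the determinant of `𝒟_t^((i))`" (render p0031:L111-L127); §4.1 (4.2) (render p0014:L17-L27)] -/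
theorem sum_detDeriv_covMatrix_mul {i : ℕ} (D E : Matrix Γ Γ ℂ) (Φ : (Fin (i + 1) → Γ) → (Fin (i + 1) → Γ) → ℂ)
    (hV : ∀ (σ : Equiv.Perm (Fin (i + 1))) (V W : Fin (i + 1) → Γ),
      Φ (V ∘ σ) W = ((Equiv.Perm.sign σ : ℤ) : ℂ) * Φ V W)
    (hW : ∀ (σ : Equiv.Perm (Fin (i + 1))) (V W : Fin (i + 1) → Γ),
      Φ V (W ∘ σ) = ((Equiv.Perm.sign σ : ℤ) : ℂ) * Φ V W) :
    ∑ V : Fin (i + 1) → Γ, ∑ W : Fin (i + 1) → Γ, detDeriv (covMatrix D V W) (covMatrix E V W) * Φ V W =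
      (((i + 1) * Nat.factorial (i + 1) : ℕ) : ℂ) *
        ∑ V : Fin (i + 1) → Γ, ∑ W : Fin (i + 1) → Γ,
          (E (V (Fin.last i)) (W (Fin.last i)) * ∏ k : Fin i, D (V (Fin.castSucc k)) (W (Fin.castSucc k))) * Φ V W := by
  -- sign bookkeeping
  have hsgn : ∀ σ : Equiv.Perm (Fin (i + 1)),
      ((Equiv.Perm.sign σ : ℤ) : ℂ) * ((Equiv.Perm.sign σ⁻¹ : ℤ) : ℂ) = 1 := by
    intro σ
    rw [Equiv.Perm.sign_inv, ← Int.cast_mul, ← Units.val_mul, Int.units_mul_self, Units.val_one, Int.cast_one]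
  -- the line-weight with the special line at position `l`
  have hentry : ∀ (V W : Fin (i + 1) → Γ) (l : Fin (i + 1)) (σ : Equiv.Perm (Fin (i + 1))) (k : Fin (i + 1)),
      (covMatrix D V W).updateCol l (fun k' => covMatrix E V W k' l) (σ k) k =
        (if k = l then E else D) (V (σ k)) (W k) := by
    intro V W l σ k
    rw [Matrix.updateCol_apply]
    by_cases hk : k = l
    · subst hk; simp [covMatrix]
    · simp [covMatrix, hk]
  -- Step 1: expand, collapse the permutation sum
  have step1 : ∀ (l : Fin (i + 1)) (W : Fin (i + 1) → Γ),
      ∑ V : Fin (i + 1) → Γ, ((covMatrix D V W).updateCol l (fun k' => covMatrix E V W k' l)).det * Φ V W =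
        ((Nat.factorial (i + 1) : ℕ) : ℂ) *
          ∑ V : Fin (i + 1) → Γ, (∏ k, (if k = l then E else D) (V k) (W k)) * Φ V W := by
    intro l W
    simp only [Matrix.det_apply, hentry, Finset.sum_mul, Units.smul_def, zsmul_eq_mul]
    rw [Finset.sum_comm]
    have hσ : ∀ σ : Equiv.Perm (Fin (i + 1)),
        ∑ V : Fin (i + 1) → Γ, ((Equiv.Perm.sign σ : ℤ) : ℂ) * (∏ k, (if k = l then E else D) (V (σ k)) (W k)) * Φ V W =
          ∑ V : Fin (i + 1) → Γ, (∏ k, (if k = l then E else D) (V k) (W k)) * Φ V W := by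
      intro σ
      rw [← sum_comp_perm_arg σ⁻¹]
      refine Finset.sum_congr rfl fun V _ => ?_
      have hk : ∀ k, (V ∘ ⇑σ⁻¹) (σ k) = V k := fun k => by simp
      simp only [hk, hV]
      rw [mul_mul_mul_comm, hsgn, one_mul]
    simp only [hσ, Finset.sum_const, Finset.card_univ, Fintype.card_perm, Fintype.card_fin, nsmul_eq_mul]
  -- Step 2: every `l` gives the same contribution as `l = last`
  have step2 : ∀ l : Fin (i + 1),
      ∑ W : Fin (i + 1) → Γ, ∑ V : Fin (i + 1) → Γ, (∏ k, (if k = l then E else D) (V k) (W k)) * Φ V W =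
        ∑ W : Fin (i + 1) → Γ, ∑ V : Fin (i + 1) → Γ,
          (E (V (Fin.last i)) (W (Fin.last i)) * ∏ k : Fin i, D (V (Fin.castSucc k)) (W (Fin.castSucc k))) * Φ V W := by
    intro l
    set τ : Equiv.Perm (Fin (i + 1)) := Equiv.swap l (Fin.last i) with hτ
    rw [← sum_comp_perm_arg τ]
    refine Finset.sum_congr rfl fun W _ => ?_
    rw [← sum_comp_perm_arg τ]
    refine Finset.sum_congr rfl fun V _ => ?_
    have hsq : ((Equiv.Perm.sign τ : ℤ) : ℂ) * ((Equiv.Perm.sign τ : ℤ) : ℂ) = 1 := by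
      rw [← Int.cast_mul, ← Units.val_mul, Int.units_mul_self, Units.val_one, Int.cast_one]
    rw [hV, hW, ← mul_assoc, ← mul_assoc, mul_assoc (∏ k, _), hsq, mul_one]
    congr 1
    have hre : ∏ k, (if k = l then E else D) ((V ∘ ⇑τ) k) ((W ∘ ⇑τ) k) =
        ∏ k, (if τ k = l then E else D) (V k) (W k) := by
      rw [← Equiv.prod_comp τ (fun k => (if τ k = l then E else D) (V k) (W k))]
      refine Finset.prod_congr rfl fun k _ => ?_
      simp only [Function.comp_apply, hτ, Equiv.swap_apply_self]
    rw [hre, Fin.prod_univ_castSucc]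
    have hlast : τ (Fin.last i) = l := by rw [hτ, Equiv.swap_apply_right]
    have hcs : ∀ k : Fin i, τ (Fin.castSucc k) ≠ l := by
      intro k hk
      have h2 : τ (τ (Fin.castSucc k)) = τ l := by rw [hk]
      rw [hτ, Equiv.swap_apply_self, Equiv.swap_apply_left] at h2
      exact (Fin.castSucc_lt_last k).ne h2
    simp only [hlast, if_true, hcs, if_false, mul_comm]
  -- assemble: `Σ_V Σ_W Σ_l` → `Σ_l Σ_W Σ_V`, collapse `σ`, then `l`
  simp only [detDeriv, Finset.sum_mul]
  rw [Finset.sum_comm]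
  simp_rw [Finset.sum_comm (s := (univ : Finset (Fin (i + 1) → Γ))) (t := (univ : Finset (Fin (i + 1))))]
  simp only [step1, ← Finset.mul_sum, step2, Finset.sum_const, Finset.card_univ, Fintype.card_fin, nsmul_eq_mul]
  conv_rhs => rw [Finset.sum_comm]
  push_cast
  ring

end DetCollapse

section Transport

variable {R : Type*} [CommRing R] {Γ : Type*}

/-- A permutation of the internal legs `V` of the first vertex is a permutation of its full argument string
(acting on the last `n` slots), with the same sign. [cite: Salmhofer1998, Appendix B (render p0031:L130-L134)] -/
theorem argA_comp_perm {P n m : ℕ} (hn : n ≤ P) (hm : P - n ≤ m) (X : Fin m → Γ) (V : Fin n → Γ)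
    (σ : Equiv.Perm (Fin n)) :
    ∃ σ' : Equiv.Perm (Fin P), Equiv.Perm.sign σ' = Equiv.Perm.sign σ ∧
      (fun j : Fin P => if hj : (j : ℕ) < P - n then X ⟨j, by omega⟩ else (V ∘ σ) ⟨j - (P - n), by omega⟩) =
        (fun j : Fin P => if hj : (j : ℕ) < P - n then X ⟨j, by omega⟩ else V ⟨j - (P - n), by omega⟩) ∘ σ' := by
  classical
  let f : Fin n ≃ {j : Fin P // ¬((j : ℕ) < P - n)} :=
    { toFun := fun k => ⟨⟨P - n + k, by omega⟩, by simp⟩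
      invFun := fun j => ⟨(j.1 : ℕ) - (P - n), by have := j.2; have := j.1.isLt; omega⟩
      left_inv := fun k => by ext; simp
      right_inv := fun j => by
        ext
        have := j.2
        simp only [not_lt] at this
        simp only
        omega }
  refine ⟨σ.extendDomain f, Equiv.Perm.sign_extendDomain σ f, ?_⟩
  funext j
  by_cases hj : (j : ℕ) < P - n
  · simp only [Function.comp_apply, Equiv.Perm.extendDomain_apply_not_subtype σ f (show ¬¬((j : ℕ) < P - n) from
      fun h => h hj), dif_pos hj]
  · rw [Function.comp_apply, Equiv.Perm.extendDomain_apply_subtype σ f hj, dif_neg hj]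
    have hval : ((f (σ (f.symm ⟨j, hj⟩)) : Fin P) : ℕ) = P - n + (σ (f.symm ⟨j, hj⟩) : ℕ) := rfl
    rw [dif_neg (by rw [hval]; omega)]
    simp only [Function.comp_apply]
    congr 1
    ext
    simp only [hval, Nat.add_sub_cancel_left]
    rfl

/-- A permutation of the internal legs `W` of the second vertex (entered reversed, `W̃`) is a permutation of its full
argument string (acting on the first `n` slots), with the same sign. [cite: Salmhofer1998, Appendix B (render p0031:L136-L144)] -/
theorem argB_comp_perm {P Q n m : ℕ} (h : n ≤ P ∧ n ≤ Q ∧ P + Q = m + 2 * n) (X : Fin m → Γ) (W : Fin n → Γ)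
    (σ : Equiv.Perm (Fin n)) :
    ∃ σ' : Equiv.Perm (Fin Q), Equiv.Perm.sign σ' = Equiv.Perm.sign σ ∧
      (fun j : Fin Q => if hj : (j : ℕ) < n then (W ∘ σ) ⟨n - 1 - j, by omega⟩ else X ⟨P - n + (j - n), by omega⟩) =
        (fun j : Fin Q => if hj : (j : ℕ) < n then W ⟨n - 1 - j, by omega⟩ else X ⟨P - n + (j - n), by omega⟩) ∘ σ' := by
  classical
  let g : Fin n ≃ {j : Fin Q // (j : ℕ) < n} :=
    { toFun := fun k => ⟨⟨n - 1 - k, by omega⟩, by simp; omega⟩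
      invFun := fun j => ⟨n - 1 - (j.1 : ℕ), by have := j.2; omega⟩
      left_inv := fun k => by ext; simp; omega
      right_inv := fun j => by
        ext
        have := j.2
        simp only
        omega }
  refine ⟨σ.extendDomain g, Equiv.Perm.sign_extendDomain σ g, ?_⟩
  funext j
  by_cases hj : (j : ℕ) < n
  · rw [Function.comp_apply, Equiv.Perm.extendDomain_apply_subtype σ g hj, dif_pos hj]
    have hval : ((g (σ (g.symm ⟨j, hj⟩)) : Fin Q) : ℕ) = n - 1 - (σ (g.symm ⟨j, hj⟩) : ℕ) := rfl
    rw [dif_pos (by rw [hval]; omega)]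
    simp only [Function.comp_apply]
    congr 1
    ext
    simp only [hval]
    have hlt := (σ (g.symm ⟨j, hj⟩)).isLt
    rw [show n - 1 - (n - 1 - (σ (g.symm ⟨j, hj⟩) : ℕ)) = (σ (g.symm ⟨j, hj⟩) : ℕ) by omega]
    rfl
  · simp only [Function.comp_apply, Equiv.Perm.extendDomain_apply_not_subtype σ g hj, dif_neg hj]

end Transport

section PairTerm

variable {Γ : Type*} [Fintype Γ] [DecidableEq Γ]

omit [DecidableEq Γ] in
/-- Contracted leg with a distinguished last line carrying `E` (the line fixed by the two derivatives). [cite: Salmhofer1998, Appendix B, the line `Ċ_t(X,Y)` of `P(X,ψ)` (render p0030:L19-L27, L83-L96)] -/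
theorem kernel_contr' {R : Type*} [CommRing R] (D E : Matrix Γ Γ R) {p q i m : ℕ}
    (h : i ≤ p ∧ i ≤ q ∧ p + q = m + 2 * i) {A : (Fin (p + 1) → Γ) → R}
    (hA : ∀ (σ : Equiv.Perm (Fin (p + 1))) (Y : Fin (p + 1) → Γ), A (Y ∘ σ) = ((Equiv.Perm.sign σ : ℤ) : R) * A Y)
    (B : (Fin (q + 1) → Γ) → R) (Z : Fin m → Γ) :
    (∑ V : Fin (i + 1) → Γ, ∑ W : Fin (i + 1) → Γ,
          (E (V (Fin.last i)) (W (Fin.last i)) * ∏ k : Fin i, D (V (Fin.castSucc k)) (W (Fin.castSucc k))) *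
          (A (fun j : Fin (p + 1) => if hj : (j : ℕ) < p + 1 - (i + 1) then Z ⟨j, by omega⟩ else V ⟨j - (p + 1 - (i + 1)), by omega⟩) *
            B (fun j : Fin (q + 1) => if hj : (j : ℕ) < i + 1 then W ⟨i + 1 - 1 - j, by omega⟩ else Z ⟨p + 1 - (i + 1) + (j - (i + 1)), by omega⟩))) =
    ((-1 : R) ^ p) * ∑ x : Γ, ∑ y : Γ, E x y * (∑ V : Fin (i) → Γ, ∑ W : Fin (i) → Γ, (∏ k, D (V k) (W k)) *
          ((fun Y : Fin p → Γ => A (Fin.cons x Y)) (fun j : Fin (p) => if hj : (j : ℕ) < p - (i) then Z ⟨j, by omega⟩ else V ⟨j - (p - (i)), by omega⟩) *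
            (fun Y : Fin q → Γ => B (Fin.cons y Y)) (fun j : Fin (q) => if hj : (j : ℕ) < i then W ⟨i - 1 - j, by omega⟩ else Z ⟨p - (i) + (j - (i)), by omega⟩))) := by
  rw [sum_sum_snoc, Finset.mul_sum]
  refine Finset.sum_congr rfl fun x _ => ?_
  rw [Finset.sum_comm, Finset.mul_sum]
  refine Finset.sum_congr rfl fun y _ => ?_
  rw [Finset.mul_sum, Finset.mul_sum]
  refine Finset.sum_congr rfl fun V _ => ?_
  rw [Finset.mul_sum, Finset.mul_sum]
  refine Finset.sum_congr rfl fun W _ => ?_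
  rw [argA_snoc h.1 (by omega) Z V x, argB_snoc h.1 h.2.2 Z W y, antisymm_snoc hA]
  simp only [Fin.snoc_castSucc, Fin.snoc_last]
  ring

/-- The counting identity behind `κ_{m₁m₂i} = C(m₁,i) C(m₂,i)`: `(p+1)(q+1) · i! C(p,i) C(q,i) =
(i+1) · (i+1)! · C(p+1,i+1) C(q+1,i+1)`. [cite: Salmhofer1998, Appendix B (render p0031:L118-L125); Salmhofer1998, §4.1 (4.3) factor `i²` (render p0014:L44-L52)] -/
theorem wickCoeff_pairing (p q i : ℕ) :
    (p + 1) * (q + 1) * (Nat.factorial i * (Nat.choose p i * Nat.choose q i)) =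
      (i + 1) * Nat.factorial (i + 1) * (Nat.choose (p + 1) (i + 1) * Nat.choose (q + 1) (i + 1)) := by
  have hp := Nat.add_one_mul_choose_eq p i
  have hq := Nat.add_one_mul_choose_eq q i
  rw [Nat.factorial_succ]
  calc (p + 1) * (q + 1) * (Nat.factorial i * (Nat.choose p i * Nat.choose q i))
      = Nat.factorial i * (((p + 1) * Nat.choose p i) * ((q + 1) * Nat.choose q i)) := by ring
    _ = Nat.factorial i * ((Nat.choose (p + 1) (i + 1) * (i + 1)) * (Nat.choose (q + 1) (i + 1) * (i + 1))) := by
        rw [hp, hq]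
    _ = (i + 1) * ((i + 1) * Nat.factorial i) * (Nat.choose (p + 1) (i + 1) * Nat.choose (q + 1) (i + 1)) := by ring

omit [DecidableEq Γ] in
/-- `pairKernel` off its index set. [cite: Salmhofer1998, Proposition 2 (render p0012:L69-L106)] -/
theorem pairKernel_of_not (D E : Matrix Γ Γ ℂ) (G₁ G₂ : (n : ℕ) → (Fin n → Γ) → ℂ) {m m₁ m₂ i : ℕ}
    (h : ¬(i ≤ m₁ ∧ i ≤ m₂ ∧ m₁ + m₂ = m + 2 * i)) (X : Fin m → Γ) :
    pairKernel D E G₁ G₂ m m₁ m₂ i X = 0 := by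
  rw [pairKernel, dif_neg h]

omit [DecidableEq Γ] in
/-- `pairKernel` on its index set. [cite: Salmhofer1998, Proposition 2 (render p0012:L69-L106)] -/
theorem pairKernel_of (D E : Matrix Γ Γ ℂ) (G₁ G₂ : (n : ℕ) → (Fin n → Γ) → ℂ) {m m₁ m₂ i : ℕ}
    (h : i ≤ m₁ ∧ i ≤ m₂ ∧ m₁ + m₂ = m + 2 * i) (X : Fin m → Γ) :
    pairKernel D E G₁ G₂ m m₁ m₂ i X = ∑ V : Fin i → Γ, ∑ W : Fin i → Γ,
      detDeriv (covMatrix D V W) (covMatrix E V W) *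
        G₁ m₁ (fun j : Fin m₁ => if hj : j.val < m₁ - i then X ⟨j.val, by omega⟩ else V ⟨j.val - (m₁ - i), by omega⟩) *
        G₂ m₂ (fun j : Fin m₂ => if hj : j.val < i then W ⟨(i - 1) - j.val, by omega⟩
          else X ⟨(m₁ - i) + (j.val - i), by omega⟩) := by
  rw [pairKernel, dif_pos h]

/-- **The `(m, i)`-term of Proposition 2**: the pairing-formula term (one `-E` line from the derivatives, `i` more
`D` lines from the product formula, coefficient `(p+1)(q+1) c(p,q,i)`) equals
`κ_{p+1,q+1,i+1} · (-1)^{p+1} (-1)^{i} · pairKernel D E … (i+1)`, summed against the Wick monomials. [cite: Salmhofer1998, Proposition 2 (render p0012:L69-L106); §4.1 (4.2)-(4.3) (render p0014:L17-L52)] -/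
theorem pairing_term_eq (D E : Matrix Γ Γ ℂ) {p q i m : ℕ} (h : i ≤ p ∧ i ≤ q ∧ p + q = m + 2 * i)
    (G₁ G₂ : (n : ℕ) → (Fin n → Γ) → ℂ)
    (hG₁ : ∀ (σ : Equiv.Perm (Fin (p + 1))) (Y : Fin (p + 1) → Γ),
      G₁ (p + 1) (Y ∘ σ) = ((Equiv.Perm.sign σ : ℤ) : ℂ) * G₁ (p + 1) Y)
    (hG₂ : ∀ (σ : Equiv.Perm (Fin (q + 1))) (Y : Fin (q + 1) → Γ),
      G₂ (q + 1) (Y ∘ σ) = ((Equiv.Perm.sign σ : ℤ) : ℂ) * G₂ (q + 1) Y) :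
    (((p + 1) * (q + 1) : ℕ) : ℂ) • (((-1 : ℂ) ^ (i) * ((Nat.factorial (i) * (Nat.choose (p) (i) * Nat.choose (q) (i)) : ℕ) : ℂ)) •
      wickOrder ℂ D (presented ℂ (fun Z : Fin m → Γ => ∑ x : Γ, ∑ y : Γ, (-E) x y *
        (∑ V : Fin (i) → Γ, ∑ W : Fin (i) → Γ, (∏ k, D (V k) (W k)) *
          ((fun Y : Fin p → Γ => G₁ (p + 1) (Fin.cons x Y)) (fun j : Fin (p) => if hj : (j : ℕ) < p - (i) then Z ⟨j, by omega⟩ else V ⟨j - (p - (i)), by omega⟩) *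
            (fun Y : Fin q → Γ => G₂ (q + 1) (Fin.cons y Y)) (fun j : Fin (q) => if hj : (j : ℕ) < i then W ⟨i - 1 - j, by omega⟩ else Z ⟨p - (i) + (j - (i)), by omega⟩)))))) =
    ∑ X : Fin m → Γ, ((kappa (p + 1) (q + 1) (i + 1) : ℂ) *
      (((-1 : ℂ) ^ (p + 1) * (-1 : ℂ) ^ i) * pairKernel D E G₁ G₂ m (p + 1) (q + 1) (i + 1) X)) •
        wickOrder ℂ D (genProd ℂ X) := by
  -- the pairing kernel against `pairKernel`
  have hpk : ∀ X : Fin m → Γ, pairKernel D E G₁ G₂ m (p + 1) (q + 1) (i + 1) X =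
      (((i + 1) * Nat.factorial (i + 1) : ℕ) : ℂ) * (((-1 : ℂ) ^ p) *
        ∑ x : Γ, ∑ y : Γ, E x y * (∑ V : Fin (i) → Γ, ∑ W : Fin (i) → Γ, (∏ k, D (V k) (W k)) *
          ((fun Y : Fin p → Γ => G₁ (p + 1) (Fin.cons x Y)) (fun j : Fin (p) => if hj : (j : ℕ) < p - (i) then X ⟨j, by omega⟩ else V ⟨j - (p - (i)), by omega⟩) *
            (fun Y : Fin q → Γ => G₂ (q + 1) (Fin.cons y Y)) (fun j : Fin (q) => if hj : (j : ℕ) < i then W ⟨i - 1 - j, by omega⟩ else X ⟨p - (i) + (j - (i)), by omega⟩)))) := by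
    intro X
    rw [pairKernel_of D E G₁ G₂ (by omega) X, ← kernel_contr' D E h hG₁ (G₂ (q + 1)) X]
    have hassoc : ∀ (V W : Fin (i + 1) → Γ), detDeriv (covMatrix D V W) (covMatrix E V W) *
        G₁ (p + 1) (fun j : Fin (p + 1) => if hj : (j : ℕ) < p + 1 - (i + 1) then X ⟨j, by omega⟩ else V ⟨j - (p + 1 - (i + 1)), by omega⟩) * G₂ (q + 1) (fun j : Fin (q + 1) => if hj : (j : ℕ) < i + 1 then W ⟨i + 1 - 1 - j, by omega⟩ else X ⟨p + 1 - (i + 1) + (j - (i + 1)), by omega⟩) =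
        detDeriv (covMatrix D V W) (covMatrix E V W) *
        (G₁ (p + 1) (fun j : Fin (p + 1) => if hj : (j : ℕ) < p + 1 - (i + 1) then X ⟨j, by omega⟩ else V ⟨j - (p + 1 - (i + 1)), by omega⟩) * G₂ (q + 1) (fun j : Fin (q + 1) => if hj : (j : ℕ) < i + 1 then W ⟨i + 1 - 1 - j, by omega⟩ else X ⟨p + 1 - (i + 1) + (j - (i + 1)), by omega⟩)) :=
      fun V W => mul_assoc _ _ _
    simp only [hassoc]
    refine sum_detDeriv_covMatrix_mul D E
      (fun V W => G₁ (p + 1) (fun j : Fin (p + 1) => if hj : (j : ℕ) < p + 1 - (i + 1) then X ⟨j, by omega⟩ else V ⟨j - (p + 1 - (i + 1)), by omega⟩) * G₂ (q + 1) (fun j : Fin (q + 1) => if hj : (j : ℕ) < i + 1 then W ⟨i + 1 - 1 - j, by omega⟩ else X ⟨p + 1 - (i + 1) + (j - (i + 1)), by omega⟩))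
      (fun σ V W => ?_) (fun σ V W => ?_)
    · obtain ⟨σ', hs, heq⟩ := argA_comp_perm (P := p + 1) (n := i + 1) (by omega) (by omega) X V σ
      rw [heq, hG₁, hs, mul_assoc]
    · obtain ⟨σ', hs, heq⟩ := argB_comp_perm (P := p + 1) (Q := q + 1) (n := i + 1) (m := m) (by omega) X W σ
      rw [heq, hG₂, hs, mul_left_comm]
  have hcoef := congrArg (Nat.cast : ℕ → ℂ) (wickCoeff_pairing p q i)
  push_cast at hcoef
  have hsq : ((-1 : ℂ) ^ p) * ((-1 : ℂ) ^ p) = 1 := by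
    rw [← pow_add, Even.neg_one_pow ⟨p, rfl⟩]
  rw [presented, map_sum, Finset.smul_sum, Finset.smul_sum]
  refine Finset.sum_congr rfl fun X _ => ?_
  rw [map_smul, smul_smul, smul_smul, hpk X, kappa]
  congr 1
  set T₀ : ℂ := ∑ x : Γ, ∑ y : Γ, E x y * (∑ V : Fin (i) → Γ, ∑ W : Fin (i) → Γ, (∏ k, D (V k) (W k)) *
          ((fun Y : Fin p → Γ => G₁ (p + 1) (Fin.cons x Y)) (fun j : Fin (p) => if hj : (j : ℕ) < p - (i) then X ⟨j, by omega⟩ else V ⟨j - (p - (i)), by omega⟩) *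
            (fun Y : Fin q → Γ => G₂ (q + 1) (Fin.cons y Y)) (fun j : Fin (q) => if hj : (j : ℕ) < i then W ⟨i - 1 - j, by omega⟩ else X ⟨p - (i) + (j - (i)), by omega⟩))) with hT₀
  simp only [Matrix.neg_apply, neg_mul, Finset.sum_neg_distrib]
  rw [← hT₀]
  push_cast
  linear_combination (-((-1 : ℂ) ^ i) * T₀) * hcoef +
    ((-1 : ℂ) ^ i * (((i : ℂ) + 1) * (Nat.factorial (i + 1) : ℂ) *
      ((Nat.choose (p + 1) (i + 1) : ℂ) * (Nat.choose (q + 1) (i + 1) : ℂ))) * T₀) * hsq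

end PairTerm

section PairExpansion

variable {Γ : Type*} [Fintype Γ] [DecidableEq Γ]

omit [Fintype Γ] [DecidableEq Γ] in
/-- `Σ_{k ∈ [1, n]} f(k) = Σ_{k < n} f(k+1)`. [folklore] -/
private theorem sum_Icc_one_eq_sum_range {M : Type*} [AddCommMonoid M] (f : ℕ → M) :
    ∀ n : ℕ, ∑ k ∈ Icc 1 n, f k = ∑ k ∈ range n, f (k + 1)
  | 0 => by simp
  | n + 1 => by rw [Finset.sum_Icc_succ_top (by omega), sum_Icc_one_eq_sum_range f n, Finset.sum_range_succ]

omit [Fintype Γ] in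
/-- A monomial with more fields than labels vanishes (two equal generators). [folklore] -/
private theorem genProd_eq_zero_of_card_lt {R : Type*} [CommRing R] [Fintype Γ] {m : ℕ} (hm : Fintype.card Γ < m)
    (X : Fin m → Γ) : genProd R X = 0 := by
  have hX : ¬Function.Injective X := fun hinj => by
    have := Fintype.card_le_of_injective X hinj
    simp only [Fintype.card_fin] at this
    omega
  obtain ⟨a, b, hab, hne⟩ : ∃ a b, X a = X b ∧ a ≠ b := by
    simpa [Function.Injective] using hX
  have h : genProd R X = ExteriorAlgebra.ιMulti R m (fun k => Pi.single (X k) (1 : R)) := by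
    rw [ExteriorAlgebra.ιMulti_apply]; rfl
  rw [h]
  exact AlternatingMap.map_eq_zero_of_eq _ _ (by simp [hab]) hne

/-- **Proposition 2 for one pair of Wick coefficients** `(G₁)_{p+1}`, `(G₂)_{q+1}` (antisymmetric): the bilinear term
`(δΩ⟪G₁⟫/δψ, (-E) δΩ⟪G₂⟫/δψ)_Γ` expanded in Wick monomials, with coefficients
`κ_{p+1,q+1,i} (-1)^{p+1} (-1)^{i-1} pairKernel D E G₁ G₂ m (p+1) (q+1) i` (`i ≥ 1` internal lines incl. the `E`-line). [cite: Salmhofer1998, Proposition 2 (render p0012:L69-L106) with Appendix B (render p0030:L1 - p0031:L145)] -/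
theorem grassmannDerivPairing_wickOrder_presented_eq_pairKernel {D : Matrix Γ Γ ℂ} (hD : D.transpose = -D)
    (E : Matrix Γ Γ ℂ) {p q : ℕ} (G₁ G₂ : (n : ℕ) → (Fin n → Γ) → ℂ)
    (hG₁ : ∀ (σ : Equiv.Perm (Fin (p + 1))) (Y : Fin (p + 1) → Γ),
      G₁ (p + 1) (Y ∘ σ) = ((Equiv.Perm.sign σ : ℤ) : ℂ) * G₁ (p + 1) Y)
    (hG₂ : ∀ (σ : Equiv.Perm (Fin (q + 1))) (Y : Fin (q + 1) → Γ),
      G₂ (q + 1) (Y ∘ σ) = ((Equiv.Perm.sign σ : ℤ) : ℂ) * G₂ (q + 1) Y) :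
    grassmannDerivPairing ℂ (-E) (wickOrder ℂ D (presented ℂ (G₁ (p + 1)))) (wickOrder ℂ D (presented ℂ (G₂ (q + 1)))) =
      ∑ m ∈ range (Fintype.card Γ + 1), ∑ X : Fin m → Γ,
        (∑ i ∈ Icc 1 (p + 1 + (q + 1)),
          if 1 ≤ i ∧ p + 1 + (q + 1) = m + 2 * i then
            (kappa (p + 1) (q + 1) i : ℂ) * (((-1 : ℂ) ^ (p + 1) * (-1 : ℂ) ^ (i - 1)) *
              pairKernel D E G₁ G₂ m (p + 1) (q + 1) i X)
          else 0) • wickOrder ℂ D (genProd ℂ X) := by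
  rw [grassmannDerivPairing_wickOrder_presented ℂ hD (-E) (G₁ (p + 1)) hG₁ (G₂ (q + 1)) hG₂]
  -- the common summand
  have hLT : ∀ m i : ℕ, (if h : i ≤ p ∧ i ≤ q ∧ p + (q) = m + 2 * i then
        (((p + 1) * (q + 1) : ℕ) : ℂ) • (((-1 : ℂ) ^ (i) * ((Nat.factorial (i) * (Nat.choose (p) (i) * Nat.choose (q) (i)) : ℕ) : ℂ)) •
          wickOrder ℂ D (presented ℂ (fun Z : Fin m → Γ => ∑ x : Γ, ∑ y : Γ, (-E) x y *
            (∑ V : Fin (i) → Γ, ∑ W : Fin (i) → Γ, (∏ k, D (V k) (W k)) *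
          ((fun Y : Fin p → Γ => G₁ (p + 1) (Fin.cons x Y)) (fun j : Fin (p) => if hj : (j : ℕ) < p - (i) then Z ⟨j, by omega⟩ else V ⟨j - (p - (i)), by omega⟩) *
            (fun Y : Fin q → Γ => G₂ (q + 1) (Fin.cons y Y)) (fun j : Fin (q) => if hj : (j : ℕ) < i then W ⟨i - 1 - j, by omega⟩ else Z ⟨p - (i) + (j - (i)), by omega⟩))))))
        else 0) =
      ∑ X : Fin m → Γ, (if 1 ≤ i + 1 ∧ p + 1 + (q + 1) = m + 2 * (i + 1) then
          (kappa (p + 1) (q + 1) (i + 1) : ℂ) * (((-1 : ℂ) ^ (p + 1) * (-1 : ℂ) ^ (i + 1 - 1)) *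
            pairKernel D E G₁ G₂ m (p + 1) (q + 1) (i + 1) X)
        else 0) • wickOrder ℂ D (genProd ℂ X) := by
    intro m i
    by_cases hc : i ≤ p ∧ i ≤ q ∧ p + (q) = m + 2 * i
    · rw [dif_pos hc, pairing_term_eq D E hc G₁ G₂ hG₁ hG₂]
      refine Finset.sum_congr rfl fun X _ => ?_
      rw [if_pos (by omega), Nat.add_sub_cancel]
    · rw [dif_neg hc]
      symm
      refine Finset.sum_eq_zero fun X _ => ?_
      by_cases hc' : 1 ≤ i + 1 ∧ p + 1 + (q + 1) = m + 2 * (i + 1)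
      · rw [if_pos hc', pairKernel_of_not D E G₁ G₂ (by omega) X, mul_zero, mul_zero, zero_smul]
      · rw [if_neg hc', zero_smul]
  simp only [hLT]
  -- the right side as a double sum over `(m, i)` with `i` shifted by one
  simp only [Finset.sum_smul]
  simp_rw [Finset.sum_comm (s := (univ : Finset (Fin _ → Γ))) (t := Icc 1 (p + 1 + (q + 1))),
    sum_Icc_one_eq_sum_range]
  -- common refinement of the two index boxes
  have hzero_i : ∀ m i : ℕ, p + 1 ≤ i →
      ∑ X : Fin m → Γ, (if 1 ≤ i + 1 ∧ p + 1 + (q + 1) = m + 2 * (i + 1) then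
          (kappa (p + 1) (q + 1) (i + 1) : ℂ) * (((-1 : ℂ) ^ (p + 1) * (-1 : ℂ) ^ (i + 1 - 1)) *
            pairKernel D E G₁ G₂ m (p + 1) (q + 1) (i + 1) X)
        else 0) • wickOrder ℂ D (genProd ℂ X) = 0 := by
    intro m i hi
    refine Finset.sum_eq_zero fun X _ => ?_
    by_cases hc' : 1 ≤ i + 1 ∧ p + 1 + (q + 1) = m + 2 * (i + 1)
    · rw [if_pos hc', pairKernel_of_not D E G₁ G₂ (by omega) X, mul_zero, mul_zero, zero_smul]
    · rw [if_neg hc', zero_smul]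
  have hzero_m : ∀ m i : ℕ, p + q + 1 ≤ m →
      ∑ X : Fin m → Γ, (if 1 ≤ i + 1 ∧ p + 1 + (q + 1) = m + 2 * (i + 1) then
          (kappa (p + 1) (q + 1) (i + 1) : ℂ) * (((-1 : ℂ) ^ (p + 1) * (-1 : ℂ) ^ (i + 1 - 1)) *
            pairKernel D E G₁ G₂ m (p + 1) (q + 1) (i + 1) X)
        else 0) • wickOrder ℂ D (genProd ℂ X) = 0 := by
    intro m i hm
    refine Finset.sum_eq_zero fun X _ => ?_
    rw [if_neg (by omega), zero_smul]
  have hzero_card : ∀ m i : ℕ, Fintype.card Γ + 1 ≤ m →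
      ∑ X : Fin m → Γ, (if 1 ≤ i + 1 ∧ p + 1 + (q + 1) = m + 2 * (i + 1) then
          (kappa (p + 1) (q + 1) (i + 1) : ℂ) * (((-1 : ℂ) ^ (p + 1) * (-1 : ℂ) ^ (i + 1 - 1)) *
            pairKernel D E G₁ G₂ m (p + 1) (q + 1) (i + 1) X)
        else 0) • wickOrder ℂ D (genProd ℂ X) = 0 := by
    intro m i hm
    refine Finset.sum_eq_zero fun X _ => ?_
    rw [genProd_eq_zero_of_card_lt (by omega) X, map_zero, smul_zero]
  rw [Finset.sum_subset (Finset.range_subset_range.2 (show p + (q) + 1 ≤ p + q + 1 + (Fintype.card Γ + 1) by omega))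
      (fun m hm hm' => by
        rw [Finset.mem_range] at hm hm'
        exact Finset.sum_eq_zero fun i _ => hzero_m m i (by omega)),
    Finset.sum_subset (Finset.range_subset_range.2 (show Fintype.card Γ + 1 ≤ p + q + 1 + (Fintype.card Γ + 1) by omega))
      (fun m hm hm' => by
        rw [Finset.mem_range] at hm hm'
        exact Finset.sum_eq_zero fun i _ => hzero_card m i (by omega))]
  refine Finset.sum_congr rfl fun m _ => ?_
  exact Finset.sum_subset (Finset.range_subset_range.2 (by omega)) fun i hi hi' => by
    rw [Finset.mem_range] at hi hi'
    exact hzero_i m i (by omega)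

end PairExpansion

section Assembly

variable {Γ : Type*} [Fintype Γ] [DecidableEq Γ]

omit [Fintype Γ] [DecidableEq Γ] in
/-- The Boolean index test `MIndex` as a proposition. [cite: Salmhofer1998, Proposition 2, `𝓜_(r₁r₂m)` (render p0012:L95-L98)] -/
theorem MIndex_eq_true_iff (mbar : ℕ → ℕ) (r₁ r₂ m m₁ m₂ i : ℕ) :
    MIndex mbar r₁ r₂ m m₁ m₂ i = true ↔
      (1 ≤ i ∧ 1 ≤ m₁ ∧ m₁ ≤ mbar r₁ ∧ 1 ≤ m₂ ∧ m₂ ≤ mbar r₂ ∧ m₁ + m₂ = m + 2 * i ∧ m₁ % 2 = 0 ∧ m₂ % 2 = 0) := by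
  simp only [MIndex, Bool.and_eq_true, decide_eq_true_eq, and_assoc]

/-- The expansion of an element in Wick-ordered presented polynomials over ANY index range containing the
degrees where its Wick coefficients live: degrees above `|Γ|` carry the zero monomials, degrees above `m̄` carry
zero coefficients. [cite: Salmhofer1998, §3.2 (3.12) (render p0011:L167-L175)] -/
theorem eq_algebraMap_add_sum_Icc (D : Matrix Γ Γ ℂ) (F : GrassmannAlgebra ℂ Γ) {M : ℕ}
    (hM : ∀ (m : ℕ) (X : Fin m → Γ), M < m → wickKernel ℂ D F m X = 0) :
    F = algebraMap ℂ _ (wickKernel ℂ D F 0 default) +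
      ∑ m ∈ Icc 1 M, wickOrder ℂ D (presented ℂ (wickKernel ℂ D F m)) := by
  have h1 : F = ∑ m ∈ range (Fintype.card Γ + 1), wickOrder ℂ D (presented ℂ (wickKernel ℂ D F m)) := by
    conv_lhs => rw [eq_sum_presented_wickKernel ℂ D F]
    simp only [presented, map_sum, map_smul]
  have hcard : ∀ m, Fintype.card Γ + 1 ≤ m → wickOrder ℂ D (presented ℂ (wickKernel ℂ D F m)) = 0 := by
    intro m hm
    rw [presented, Finset.sum_eq_zero fun X _ => by rw [genProd_eq_zero_of_card_lt (by omega) X, smul_zero], map_zero]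
  have hbig : ∀ m, M + 1 ≤ m → wickOrder ℂ D (presented ℂ (wickKernel ℂ D F m)) = 0 := by
    intro m hm
    rw [presented, Finset.sum_eq_zero fun X _ => by rw [hM m X (by omega), zero_smul], map_zero]
  nth_rewrite 1 [h1]
  rw [Finset.sum_subset (Finset.range_subset_range.2 (show Fintype.card Γ + 1 ≤ Fintype.card Γ + 1 + (M + 1) by omega))
    (fun m hm hm' => by rw [Finset.mem_range] at hm hm'; exact hcard m (by omega)),
    ← Finset.sum_subset (Finset.range_subset_range.2 (show M + 1 ≤ Fintype.card Γ + 1 + (M + 1) by omega))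
    (fun m hm hm' => by rw [Finset.mem_range] at hm hm'; exact hbig m (by omega)),
    Finset.sum_range_succ', sum_Icc_one_eq_sum_range, presented_fin_zero, wickOrder_algebraMap, add_comm]

/-- **Salmhofer 1998, Proposition 2 with (3.16)–(3.17), SIGN EXHIBITED**: the Wick-reordering identity of
`WickReorderingFormula` holds with `σ(i) = (-1)^{i-1}` (`wickReorderSign`) — the orientation of (4.3) at `i = 1`, of
the display of Proposition 2 at `i = 2`, alternating thereafter; i.e. the cell's re-derivation of Appendix B recorded
in `Salmhofer1998WickReordering.lean` (module docstring "SIGN", flag S-t7g12-1) is kernel-checked.  For `Γ` finite,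
`D`, `Ḋ` antisymmetric, `(𝒢_r)` even with Wick coefficients `G_{m,r} = wickKernel D 𝒢_r m` vanishing above `m̄(r)`:
`Σ_{r₁+r₂=r} (δ𝒢_{r₁}/δψ, (-Ḋ) δ𝒢_{r₂}/δψ)_Γ = Σ_m Σ_X [∫dκ_{mr} Σ_{V,W} (-1)^{i-1} ∂det𝒟^{(i)}(V,W) G(X₁,V) G(W̃,X₂)] Ω_D(ψ(X))`.
(The hypothesis `Ḋᵀ = -Ḋ` of the named fact is not needed.)
[cite: Salmhofer1998, Proposition 2 (render p0012:L69-L106); (3.16)-(3.17) (render p0012:L47-L63); §4.1 (4.2)-(4.3) (render p0014:L17-L52); Appendix B (render p0030:L1 - p0031:L145, Lemma 10 p0030:L98-L122)] -/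
theorem wickReorderingFormula_wickReorderSign (Γ : Type) [Fintype Γ] [DecidableEq Γ] (D Ddot : Matrix Γ Γ ℂ)
    (hD : D.transpose = -D) (mbar : ℕ → ℕ) (𝒢 : ℕ → GrassmannAlgebra ℂ Γ) (heven : ∀ r, 𝒢 r ∈ evenOdd ℂ 0)
    (hvan : ∀ (r m : ℕ) (X : Fin m → Γ), mbar r < m → wickKernel ℂ D (𝒢 r) m X = 0) (r : ℕ) :
    ∑ r₁ ∈ Finset.Icc 1 (r - 1), grassmannDerivPairing ℂ (-Ddot) (𝒢 r₁) (𝒢 (r - r₁)) =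
      ∑ m ∈ Finset.range (Fintype.card Γ + 1), ∑ X : Fin m → Γ,
        wickReorderKernel wickReorderSign mbar D Ddot (fun r' m' => wickKernel ℂ D (𝒢 r') m') m r X •
          wickOrder ℂ D (genProd ℂ X) := by
  -- antisymmetry and parity of the Wick coefficients
  have hanti : ∀ (r' m' : ℕ) (σ : Equiv.Perm (Fin m')) (Y : Fin m' → Γ),
      (fun n => wickKernel ℂ D (𝒢 r') n) m' (Y ∘ σ) =
        ((Equiv.Perm.sign σ : ℤ) : ℂ) * (fun n => wickKernel ℂ D (𝒢 r') n) m' Y :=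
    fun r' m' σ Y => by simp only [wickKernel_def, kernel_comp_perm]
  have hodd : ∀ (r' m' : ℕ), ¬(m' % 2 = 0) → wickKernel ℂ D (𝒢 r') m' = 0 := by
    intro r' m' hm'
    funext Y
    rw [wickKernel_def, Pi.zero_apply]
    exact kernel_eq_zero_of_mem_evenPart_of_odd ℂ (mem_evenPart_iff.2 (gaussConv_mem_evenOdd ℂ D (heven r')))
      (Nat.odd_iff.2 (by omega)) Y
  -- the right side, distributed and with `r₁` outermost
  simp only [wickReorderKernel, kappaSum, Finset.sum_smul]
  simp_rw [Finset.sum_comm (t := Icc 1 (r - 1))]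
  refine Finset.sum_congr rfl fun r₁ _ => ?_
  simp_rw [Finset.sum_comm (t := Icc 1 (mbar (r - r₁))), Finset.sum_comm (t := Icc 1 (mbar r₁))]
  -- the left side, expanded and bilinear
  conv_lhs => rw [eq_algebraMap_add_sum_Icc D (𝒢 r₁) (fun m X hm => hvan r₁ m X hm)]
  conv_lhs => rw [eq_algebraMap_add_sum_Icc D (𝒢 (r - r₁)) (fun m X hm => hvan (r - r₁) m X hm)]
  rw [grassmannDerivPairing_algebraMap_add, grassmannDerivPairing_sum_sum]
  refine Finset.sum_congr rfl fun m₁ hm₁ => Finset.sum_congr rfl fun m₂ hm₂ => ?_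
  simp only [← Finset.sum_smul]
  rw [Finset.mem_Icc] at hm₁ hm₂
  obtain ⟨p, rfl⟩ : ∃ p, m₁ = p + 1 := ⟨m₁ - 1, by omega⟩
  obtain ⟨q, rfl⟩ : ∃ q, m₂ = q + 1 := ⟨m₂ - 1, by omega⟩
  by_cases hpar : (p + 1) % 2 = 0 ∧ (q + 1) % 2 = 0
  · -- both degrees even: Proposition 2 for the pair, then match the index test
    rw [grassmannDerivPairing_wickOrder_presented_eq_pairKernel hD Ddot (fun n => wickKernel ℂ D (𝒢 r₁) n)
      (fun n => wickKernel ℂ D (𝒢 (r - r₁)) n) (hanti r₁ (p + 1)) (hanti (r - r₁) (q + 1))]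
    refine Finset.sum_congr rfl fun m _ => Finset.sum_congr rfl fun X _ => ?_
    congr 1
    refine Finset.sum_congr rfl fun i _ => ?_
    have hM : MIndex mbar r₁ (r - r₁) m (p + 1) (q + 1) i = true ↔ (1 ≤ i ∧ p + 1 + (q + 1) = m + 2 * i) := by
      rw [MIndex_eq_true_iff]
      constructor
      · rintro ⟨h1, -, -, -, -, h6, -, -⟩; exact ⟨h1, h6⟩
      · rintro ⟨h1, h6⟩; exact ⟨h1, by omega, hm₁.2, by omega, hm₂.2, h6, hpar.1, hpar.2⟩
    by_cases hc : 1 ≤ i ∧ p + 1 + (q + 1) = m + 2 * i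
    · rw [if_pos hc, if_pos (hM.2 hc)]
      have hev : Even (p + 1) := Nat.even_iff.2 hpar.1
      rw [hev.neg_one_pow, one_mul, wickReorderSign]
      push_cast
      rfl
    · rw [if_neg hc, if_neg (fun h => hc (hM.1 h))]
  · -- an odd degree: the coefficient family vanishes, and the index test fails
    have hzero : wickOrder ℂ D (presented ℂ (wickKernel ℂ D (𝒢 r₁) (p + 1))) = 0 ∨
        wickOrder ℂ D (presented ℂ (wickKernel ℂ D (𝒢 (r - r₁)) (q + 1))) = 0 := by
      rcases not_and_or.1 hpar with h | h
      · left; rw [hodd r₁ (p + 1) h, presented_zero, map_zero]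
      · right; rw [hodd (r - r₁) (q + 1) h, presented_zero, map_zero]
    have hL : grassmannDerivPairing ℂ (-Ddot) (wickOrder ℂ D (presented ℂ (wickKernel ℂ D (𝒢 r₁) (p + 1))))
        (wickOrder ℂ D (presented ℂ (wickKernel ℂ D (𝒢 (r - r₁)) (q + 1)))) = 0 := by
      rcases hzero with h | h <;>
        simp only [h, grassmannDerivPairing_apply, map_zero, zero_mul, mul_zero, smul_zero, Finset.sum_const_zero]
    rw [hL]
    symm
    refine Finset.sum_eq_zero fun m _ => Finset.sum_eq_zero fun X _ => ?_
    rw [Finset.sum_eq_zero fun i _ => ?_, zero_smul]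
    rw [if_neg]
    intro hMi
    exact hpar ⟨((MIndex_eq_true_iff _ _ _ _ _ _ _).1 hMi).2.2.2.2.2.2.1, ((MIndex_eq_true_iff _ _ _ _ _ _ _).1 hMi).2.2.2.2.2.2.2⟩


/-- **DISCHARGE of the named fact `WickReorderingFormula` (licence F-078)**: Salmhofer 1998, Proposition 2 with
(3.16)–(3.17) — there are signs `σ(i) ∈ {±1}` (witness: `wickReorderSign`, `wickReorderingFormula_wickReorderSign`)
such that the order-`r` bilinear term of the RGE is Wick-reordered by the determinant formula of Appendix B.
[cite: Salmhofer1998, Proposition 2 (render p0012:L69-L106); (3.16)-(3.17) (render p0012:L47-L63); Appendix B (render p0030:L1 - p0031:L145)] -/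
theorem WickReorderingFormula_holds : WickReorderingFormula := by
  refine ⟨wickReorderSign, fun i => ?_, fun Γ _ _ D Ddot hD _ mbar 𝒢 heven hvan r =>
    wickReorderingFormula_wickReorderSign Γ D Ddot hD mbar 𝒢 heven hvan r⟩
  unfold wickReorderSign
  rcases neg_one_pow_eq_or ℤ (i - 1) with h | h
  · exact Or.inl h
  · exact Or.inr h

/-- **(3.20), "comparison of coefficients"** (render p0012:L108-L122): the Wick coefficients of the order-`r` bilinear
term are the antisymmetrised `Q_{m,r}`: `wickKernel_D(Σ_{r₁+r₂=r} (δ𝒢_{r₁}/δψ, (-Ḋ) δ𝒢_{r₂}/δψ)_Γ)_m = 𝔸_m Q_{m,r}`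
(F7b `antisym`), for every degree `m ≤ |Γ|`, with `Q_{m,r} = wickReorderKernel (σ := wickReorderSign)`.  Together with
`hasDerivAt_wickKernel_salmhofer` (F7af: `∂_t G_m = ½ · wickKernel_{D_t}((δ𝒢/δψ, Ċ_t δ𝒢/δψ)_Γ)_m`) this is the component
RGE (3.19) `\icomRGE` in differential form. [cite: Salmhofer1998, §3.2 (3.20) `𝔸_m` (render p0012:L108-L122); (3.19) (render p0012:L152-L160)] -/
theorem wickKernel_bilinear_eq_antisym_wickReorderKernel (Γ : Type) [Fintype Γ] [DecidableEq Γ]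
    (D Ddot : Matrix Γ Γ ℂ) (hD : D.transpose = -D) (mbar : ℕ → ℕ) (𝒢 : ℕ → GrassmannAlgebra ℂ Γ)
    (heven : ∀ r, 𝒢 r ∈ evenOdd ℂ 0)
    (hvan : ∀ (r m : ℕ) (X : Fin m → Γ), mbar r < m → wickKernel ℂ D (𝒢 r) m X = 0) (r m : ℕ)
    (hm : m ≤ Fintype.card Γ) (X : Fin m → Γ) :
    wickKernel ℂ D (∑ r₁ ∈ Finset.Icc 1 (r - 1), grassmannDerivPairing ℂ (-Ddot) (𝒢 r₁) (𝒢 (r - r₁))) m X =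
      antisym (wickReorderKernel wickReorderSign mbar D Ddot (fun r' m' => wickKernel ℂ D (𝒢 r') m') m r) X := by
  rw [wickReorderingFormula_wickReorderSign Γ D Ddot hD mbar 𝒢 heven hvan r]
  have hpres : ∀ m' : ℕ, ∑ Y : Fin m' → Γ,
      wickReorderKernel wickReorderSign mbar D Ddot (fun r' m' => wickKernel ℂ D (𝒢 r') m') m' r Y •
        wickOrder ℂ D (genProd ℂ Y) =
      wickOrder ℂ D (presented ℂ (wickReorderKernel wickReorderSign mbar D Ddot
        (fun r' m' => wickKernel ℂ D (𝒢 r') m') m' r)) := by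
    intro m'
    simp only [presented, map_sum, map_smul]
  simp only [hpres, wickKernel_def, map_sum, kernel_sum, gaussConv_wickOrder]
  rw [Finset.sum_eq_single_of_mem m (Finset.mem_range.2 (by omega))
    (fun m' _ hm' => kernel_presented_of_ne ℂ _ X (Ne.symm hm')), kernel_presented, antisym]
  simp only [Units.smul_def, zsmul_eq_mul, Rat.smul_one_eq_cast, Rat.cast_inv, Rat.cast_natCast, Complex.real_smul,
    Complex.ofReal_inv, Complex.ofReal_natCast]

end Assembly

end Salmhofer1998

end Literature.MathematicalPhysics.QuantumLattice.FermiRG
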